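import Literature.Analysis.FluidPDE.DuchonRobertCubicIdentity
import Literature.Analysis.FluidPDE.LerayResolvedEnergyDistributional
import HarnessLib

/-!
# Duchon–Robert's tested momentum equation — discharge of `symmTestField_identity`

Sorry-free proof `Torus.symmTestField_identity_holds` of the named fact
`Torus.IsDistributionalNSSolutionOn.symmTestField_identity` of
`Literature.Analysis.FluidPDE.DuchonRobertLocalBalance` — the last of the five printed steps in the
tree's decomposition of Duchon–Robert 2000, Prop. 1–2 (the others: `integral_kernelFlux_mul_eq_holds`,
`tendsto_mollified_transport_holds`, `tendsto_pressure_pairing_holds`, `tendsto_viscous_pairing_holds`).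
The fact (Duchon–Robert 2000, proof of Prop. 1, p. 250: the regularised equation
`∂ₜu^ε + ∂ⱼ(uⱼu)^ε + ∇p^ε = νΔu^ε` "multiplied by `u`, the equation for `u` by `u^ε`, and the two
added") says: for a distributional Navier–Stokes/Euler solution `(u, p)` on `T^d × (0,T)` with
`u ∈ L³_{t,x}`, `p ∈ L^{3/2}_{t,x}`, a smooth even kernel `K` and a scalar test function `ψ`
supported in `(0,T)`, the weak formulation holds for the symmetric field
`Φ = ψ u^K + (ψu) ⋆ K` (`Torus.symmTestField`), with time-derivative pairing `∫∫ ⟪u, u^K⟫ ∂ₜψ`: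
`∫₀ᵀ∫ ⟪u,u^K⟫∂ₜψ + ∫₀ᵀ∫ ⟪u,(u·∇)Φ⟫ + ν∫₀ᵀ∫ ⟪u,ΔΦ⟫ + ∫₀ᵀ∫ p div Φ = 0`.

## The proof (CCFS 2008, §3.1, time mollification; as in the tree's `OnsagerCCFSTestField`)

`Φ` is smooth in space but only `L³` in time, so it is not an admissible test field. With
normalised even bumps `ρₙ` in time (radii `→ 0`, smaller than the distance of `supp ψ` to
`{0,T}`), the extended velocity `ū = 𝟙_{(0,T)} u` (strongly measurable representatives `Uⱼ` of
its components), the extended pressure `p̄`, and the space–time mollification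
`𝒮ₙ = ⋆_{t,x} (ρₙ ⊗ K)` (`Torus.stConv`), we test with the fields of components
`Φₙⱼ = ψ · 𝒮ₙUⱼ + 𝒮ₙ(ψUⱼ)` (`Torus.drTest`): smooth on `ℝ × T^d` (`Torus.contDiff_top_stLift_stConv`),
compactly supported in `(0,T)` in time; no divergence-freeness is needed since the pressure is
explicit. In the resulting identity (`weakForm_rewrite_pressure`: the distributional identity read
on `ℝ × T^d`, four sums over components):

* the **time-derivative pairing collapses exactly** (`integral_mul_timeDeriv_drTest`):
  `∂ₜΦₙⱼ = ∂ₜψ 𝒮ₙUⱼ + ψ 𝒮ₙ'Uⱼ + 𝒮ₙ'(ψUⱼ)` (`𝒮ₙ' = ⋆(ρₙ' ⊗ K)`), and by the odd–even duality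
  `∫ Uⱼ 𝒮ₙ'(ψUⱼ) = −∫ ψUⱼ 𝒮ₙ'Uⱼ` (`Torus.integral_mul_stConv_odd_even`) the last two terms cancel:
  `∫ Uⱼ ∂ₜΦₙⱼ = ∫ ∂ₜψ Uⱼ 𝒮ₙUⱼ` — the weak form of `u·∂ₜu^ε + u^ε·∂ₜu = ∂ₜ(u·u^ε)`;
* **all space derivatives converge in `L³(ℝ × T^d)`**: `𝒮ₙF = ρₙ ⋆ₜ (F ⋆ₓ K) → F ⋆ₓ K`
  (`tendsto_eLpNorm_stConv_sub_sliceConv`, from the tree's `tendsto_eLpNorm_timeConv_sub`) for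
  `F ∈ {Uⱼ, ψUⱼ}` and the kernels `K, ∂ᵢK, ∂ᵢ∂ᵢK`, so that `∂ᵢΦₙⱼ`, `ΔΦₙⱼ`, `div Φₙ`
  (`partialDeriv_drTest`, `laplacian_drTest`) converge in `L³` to the corresponding slice-wise
  expressions, against the fixed factors `Uⱼ`, `UⱼUᵢ`, `p̄ ∈ L^{3/2}`
  (`tendsto_integral_mul_of_tendsto_eLpNorm_three`);
* **identification** at a.e. time with the derivatives of `Φ(t) = symmTestField K (ψ t) (u t)`
  (`partialDeriv_symmTestField_kernel`, `laplacian_symmTestField_apply`,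
  `divergence_symmTestField_eq_sum`, and Fubini back to iterated integrals over `(0,T)`).

## References

* J. Duchon, R. Robert, *Inertial energy dissipation for weak solutions of incompressible Euler and
  Navier–Stokes equations*, Nonlinearity 13 (2000) 249–255, proof of Prop. 1, p. 250. [DuchonRobert2000]
* A. Cheskidov, P. Constantin, S. Friedlander, R. Shvydkoy, *Energy conservation and Onsager's
  conjecture for the Euler equations*, Nonlinearity 21 (2008) = arXiv:0704.0759, §3.1 (last
  paragraph: mollified solutions as test functions). [CCFS2008]
* P. Constantin, W. E, E. S. Titi, Comm. Math. Phys. 165 (1994), p. 208 ("The extra arguments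
  needed to mollify in time are straightforward"). [ConstantinETiti1994]

## Mathlib / tree

Mathlib (this pin): convolution, `ContDiffBump`, Hölder (`MemLp.integrable_mul`,
`eLpNorm_le_mul_eLpNorm_of_ae_le_mul`, `eLpNorm_sum_le`), Fubini; no space–time test-field API.
Tree: `OnsagerCCFSTestField` (`stBar`, `vecField`, `sliceConv`, `exists_abs_stConv_le`,
`integral_mul_stConv_odd_even`, `hasDerivAt_stConv_time`, `exists_contDiffBump_seq_lt`,
`tendsto_integral_mul_of_tendsto_eLpNorm_three`, `ae_slice_eq_of_ae_eq_stBar`),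
`TorusSpaceTimeConvolution` (`stConv`, its smoothness and derivative formulas), `TimeMollification`
(`tendsto_eLpNorm_timeConv_sub`), `DuchonRobertCubicIdentity` (`partialDeriv_symmTestField`,
`inner_convect_eq_sum`, `isSmooth_symmTestField`), `LerayResolvedEnergyDistributional`
(`laplacian_apply_eq`, `inner_laplacian_vecField`), `TorusSpaceTime` (`IsSmoothSpaceTimeOn.partialDeriv`,
`.laplacian`, `.exists_norm_le_of_isCompact`).
-/

noncomputable section

open MeasureTheory TopologicalSpace Set Function Filter Metric
open _root_.Topology
open scoped InnerProductSpace RealInnerProductSpace ENNReal NNReal Convolution ContDiff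

namespace Literature.Analysis.FluidPDE.Torus

variable {d : Type*} [Fintype d]

/-! ## Space–time mollifications converge to slice-wise mollifications in `Lᵖ(ℝ × T^d)` -/

section StConvLimit

variable {F : ℝ × UnitAddTorus d → ℝ} {k : UnitAddTorus d → ℝ}

/-- **`stConv ρₙ k F → F ⋆ₓ k` in `Lᵖ(ℝ × T^d)`** along normalised time bumps `ρₙ` with
`rOut → 0`, for `F` integrable, strongly measurable with `‖F‖_p < ∞` (`1 ≤ p < ∞`) and a continuous
space kernel `k`: a space–time mollification is the time mollification of the slice-wise space
mollification (`Torus.stConv_eq_timeConv`), which converges in `Lᵖ`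
(`FunctionSpaces.tendsto_eLpNorm_timeConv_sub`). [folklore] -/
theorem tendsto_eLpNorm_stConv_sub_sliceConv {ι : Type*} {φ : ι → ContDiffBump (0 : ℝ)}
    {l : Filter ι} [l.IsCountablyGenerated] (hφ : Tendsto (fun i => (φ i).rOut) l (𝓝 0))
    (hFm : StronglyMeasurable F) (hF : Integrable F ((volume : Measure ℝ).prod volume))
    {p : ℝ≥0∞} (hp : 1 ≤ p) (hp' : p ≠ ⊤) (hFp : eLpNorm F p ((volume : Measure ℝ).prod volume) < ⊤)
    (hk : Continuous k) :
    Tendsto (fun i => eLpNorm (fun z : ℝ × UnitAddTorus d =>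
        FunctionSpaces.Torus.stConv ((φ i).normed volume) k F z.1 z.2 - sliceConv F k z.1 z.2) p
      ((volume : Measure ℝ).prod volume)) l (𝓝 0) := by
  have hg : StronglyMeasurable (uncurry (sliceConv F k)) := stronglyMeasurable_uncurry_sliceConv hFm hk
  have hgp : eLpNorm (uncurry (sliceConv F k)) p ((volume : Measure ℝ).prod volume) < ⊤ :=
    (eLpNorm_uncurry_sliceConv_le hFm hk hp hp').trans_lt (ENNReal.mul_lt_top hk.integrable_unitAddTorus.2 hFp)
  have h := FunctionSpaces.tendsto_eLpNorm_timeConv_sub (μ := (volume : Measure (UnitAddTorus d))) hφ hg hp hp' hgp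
  refine h.congr fun i => ?_
  refine eLpNorm_congr_ae (Eventually.of_forall fun z => ?_)
  dsimp only
  rw [FunctionSpaces.Torus.stConv_eq_timeConv hF (φ i).continuous_normed (φ i).hasCompactSupport_normed hk]
  rfl

end StConvLimit

/-! ## `L³` convergence is stable under bounded coefficients and sums -/

section L3Algebra

variable {α : Type*} [MeasurableSpace α] {μ : Measure α} {ι : Type*} {l : Filter ι}

/-- A bounded measurable coefficient preserves `Lᵖ` convergence: if `‖gᵢ - g‖_p → 0` and
`|c| ≤ C`, then `‖c gᵢ - c g‖_p → 0`. [folklore] -/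
theorem tendsto_eLpNorm_mul_sub_mul {c : α → ℝ} {C : ℝ} (hc : ∀ x, |c x| ≤ C) {g : ι → α → ℝ}
    {g₀ : α → ℝ} {p : ℝ≥0∞} (h : Tendsto (fun i => eLpNorm (fun x => g i x - g₀ x) p μ) l (𝓝 0)) :
    Tendsto (fun i => eLpNorm (fun x => c x * g i x - c x * g₀ x) p μ) l (𝓝 0) := by
  have hb : ∀ i, eLpNorm (fun x => c x * g i x - c x * g₀ x) p μ ≤
      ENNReal.ofReal C * eLpNorm (fun x => g i x - g₀ x) p μ := fun i => by
    refine eLpNorm_le_mul_eLpNorm_of_ae_le_mul (Eventually.of_forall fun x => ?_) p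
    rw [← mul_sub, norm_mul, Real.norm_eq_abs]
    exact mul_le_mul_of_nonneg_right (hc x) (norm_nonneg _)
  have h0 := ENNReal.Tendsto.const_mul h (Or.inr ENNReal.ofReal_ne_top) (a := ENNReal.ofReal C)
  rw [mul_zero] at h0
  exact tendsto_of_tendsto_of_tendsto_of_le_of_le tendsto_const_nhds h0 (fun i => bot_le) hb

/-- `Lᵖ` convergence is stable under addition (`1 ≤ p`). [folklore] -/
theorem tendsto_eLpNorm_add_sub_add {f g : ι → α → ℝ} {f₀ g₀ : α → ℝ} {p : ℝ≥0∞} (hp : 1 ≤ p)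
    (hfm : ∀ᶠ i in l, AEStronglyMeasurable (fun x => f i x - f₀ x) μ)
    (hgm : ∀ᶠ i in l, AEStronglyMeasurable (fun x => g i x - g₀ x) μ)
    (hf : Tendsto (fun i => eLpNorm (fun x => f i x - f₀ x) p μ) l (𝓝 0))
    (hg : Tendsto (fun i => eLpNorm (fun x => g i x - g₀ x) p μ) l (𝓝 0)) :
    Tendsto (fun i => eLpNorm (fun x => (f i x + g i x) - (f₀ x + g₀ x)) p μ) l (𝓝 0) := by
  have hsum := hf.add hg
  rw [add_zero] at hsum
  refine tendsto_of_tendsto_of_tendsto_of_le_of_le' tendsto_const_nhds hsum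
    (Eventually.of_forall fun i => bot_le) ?_
  filter_upwards [hfm, hgm] with i hfi hgi
  have e : (fun x => (f i x + g i x) - (f₀ x + g₀ x)) = (fun x => f i x - f₀ x) + fun x => g i x - g₀ x := by
    funext x; simp only [Pi.add_apply]; ring
  rw [e]
  exact eLpNorm_add_le hfi hgi hp

end L3Algebra

/-! ## Bounds for test-function data vanishing off a compact time interval -/

section TestData

/-- A jointly smooth field vanishing off a compact time interval is globally bounded. [folklore] -/
theorem exists_forall_norm_le_of_isSmoothSpaceTimeOn {F' : Type*} [NormedAddCommGroup F']
    [NormedSpace ℝ F'] {w : ℝ → UnitAddTorus d → F'} (hw : FunctionSpaces.Torus.IsSmoothSpaceTimeOn univ w)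
    {lo hi : ℝ} (h0 : ∀ t, t ∉ Icc lo hi → w t = 0) : ∃ C, 0 ≤ C ∧ ∀ t x, ‖w t x‖ ≤ C := by
  obtain ⟨C, hC⟩ := hw.exists_norm_le_of_isCompact isCompact_Icc (subset_univ (Icc lo hi))
  refine ⟨max C 0, le_max_right _ _, fun t x => ?_⟩
  by_cases ht : t ∈ Icc lo hi
  · exact (hC t ht x).trans (le_max_left _ _)
  · rw [h0 t ht]
    simp

/-- Continuity of a field from the continuity of its space–time lift (restated for fields smooth
on all of `ℝ`). [folklore] -/
theorem _root_.Literature.Analysis.FunctionSpaces.Torus.IsSmoothSpaceTimeOn.continuous_uncurry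
    {F' : Type*} [NormedAddCommGroup F'] [NormedSpace ℝ F'] {w : ℝ → UnitAddTorus d → F'}
    (hw : FunctionSpaces.Torus.IsSmoothSpaceTimeOn univ w) : Continuous (uncurry w) := by
  refine FunctionSpaces.Torus.continuous_uncurry_of_continuous_stLift ?_
  have h := hw.continuousOn_stLift
  rw [univ_prod_univ, continuousOn_univ] at h
  exact h

end TestData

/-! ## The time-mollified Duchon–Robert test components and their calculus -/

section DRTest

variable [DecidableEq d]

/-- **The time-regularised Duchon–Robert test component** built from one (representative of a)
velocity component `U : ℝ × T^d → ℝ`, a smooth even kernel `K`, a scalar space–time test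
function `ψ` and an even time bump `ρ`:
`Φ = ψ · (U ⋆_{t,x} (ρ ⊗ K)) + (ψU) ⋆_{t,x} (ρ ⊗ K)` (`Torus.stConv`). As `ρ → δ₀` this is the
component `ψ (uⱼ ⋆ K) + (ψuⱼ) ⋆ K` of Duchon–Robert's symmetric field `Torus.symmTestField`
("multiply the equation for `u` by `u^ε`, the regularised equation by `u`, and add",
Duchon–Robert 2000, proof of Prop. 1; the time mollification is the repair of CCFS 2008, §3.1). [folklore] -/
def drTest (ρ : ℝ → ℝ) (K : UnitAddTorus d → ℝ) (ψ : ℝ → UnitAddTorus d → ℝ)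
    (U : ℝ × UnitAddTorus d → ℝ) : ℝ → UnitAddTorus d → ℝ :=
  fun t x => ψ t x * FunctionSpaces.Torus.stConv ρ K U t x +
    FunctionSpaces.Torus.stConv ρ K (fun q => ψ q.1 q.2 * U q) t x

variable {ρ : ℝ → ℝ} {K : UnitAddTorus d → ℝ} {ψ : ℝ → UnitAddTorus d → ℝ} {U : ℝ × UnitAddTorus d → ℝ}
  {Cψ : ℝ}

omit [DecidableEq d] in
/-- Unfolding `drTest`. [folklore] -/
theorem drTest_apply (ρ : ℝ → ℝ) (K : UnitAddTorus d → ℝ) (ψ : ℝ → UnitAddTorus d → ℝ)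
    (U : ℝ × UnitAddTorus d → ℝ) (t : ℝ) (x : UnitAddTorus d) :
    drTest ρ K ψ U t x = ψ t x * FunctionSpaces.Torus.stConv ρ K U t x +
      FunctionSpaces.Torus.stConv ρ K (fun q => ψ q.1 q.2 * U q) t x := rfl

omit [DecidableEq d] in
/-- The cut-off field `ψU` is integrable on `ℝ × T^d` for `U ∈ L¹` and bounded continuous `ψ`. [folklore] -/
theorem integrable_cutoff_mul (hU : Integrable U ((volume : Measure ℝ).prod volume))
    (hψc : Continuous (uncurry ψ)) (hψb : ∀ t x, |ψ t x| ≤ Cψ) :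
    Integrable (fun q : ℝ × UnitAddTorus d => ψ q.1 q.2 * U q) ((volume : Measure ℝ).prod volume) :=
  hU.bdd_mul hψc.aestronglyMeasurable (Eventually.of_forall fun q => by
    rw [Real.norm_eq_abs]; exact hψb q.1 q.2)

omit [DecidableEq d] in
/-- **The test component has a smooth space–time lift** (`Torus.contDiff_top_stLift_stConv`). [folklore] -/
theorem contDiff_stLift_drTest (hU : Integrable U ((volume : Measure ℝ).prod volume))
    (hρ : ContDiff ℝ ∞ ρ) (hρc : HasCompactSupport ρ) (hK : FunctionSpaces.Torus.IsSmooth K)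
    (hψs : ContDiff ℝ ∞ (FunctionSpaces.Torus.stLift ψ)) (hψb : ∀ t x, |ψ t x| ≤ Cψ) :
    ContDiff ℝ ∞ (FunctionSpaces.Torus.stLift (drTest ρ K ψ U)) := by
  have hψc : Continuous (uncurry ψ) := FunctionSpaces.Torus.continuous_uncurry_of_continuous_stLift hψs.continuous
  have h1 := FunctionSpaces.Torus.contDiff_top_stLift_stConv hU hρ hρc hK
  have h2 := FunctionSpaces.Torus.contDiff_top_stLift_stConv (integrable_cutoff_mul hU hψc hψb) hρ hρc hK
  have e : FunctionSpaces.Torus.stLift (drTest ρ K ψ U) = fun q =>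
      FunctionSpaces.Torus.stLift ψ q * FunctionSpaces.Torus.stLift (FunctionSpaces.Torus.stConv ρ K U) q +
        FunctionSpaces.Torus.stLift (FunctionSpaces.Torus.stConv ρ K (fun q => ψ q.1 q.2 * U q)) q := by
    funext q; rfl
  rw [e]
  exact (hψs.mul h1).add h2

omit [DecidableEq d] in
/-- **Time support of the test component**: if `ψ(t) = 0` for `t ≤ a` and for `b ≤ t`, and `ρ`
vanishes off `(-δ, δ)` (`δ > 0`), then `drTest ρ K ψ U t = 0` for `t ≤ a - δ` and for `b + δ ≤ t`. [folklore] -/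
theorem drTest_eq_zero_of_dist {a b δ : ℝ} (hδ : 0 < δ) (hψab : ∀ t, (t ≤ a ∨ b ≤ t) → ψ t = 0)
    (hρδ : ∀ r, ρ r ≠ 0 → |r| < δ) {t : ℝ} (ht : t ≤ a - δ ∨ b + δ ≤ t) (x : UnitAddTorus d) :
    drTest ρ K ψ U t x = 0 := by
  have hψt : ψ t = 0 := hψab t (by rcases ht with ht | ht <;> [left; right] <;> linarith)
  rw [drTest_apply, hψt, Pi.zero_apply, zero_mul, zero_add, FunctionSpaces.Torus.stConv]
  refine integral_eq_zero_of_ae (Eventually.of_forall fun p => ?_)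
  by_cases hρp : ρ (t - p.1) = 0
  · simp [hρp]
  have h2 := hρδ _ hρp
  rw [abs_lt] at h2
  have hψp : ψ p.1 = 0 := hψab p.1 (by rcases ht with ht | ht <;> [left; right] <;> linarith)
  simp [hψp]

omit [DecidableEq d] in
/-- Time slices of a field with smooth space–time lift are differentiable in time with derivative
`∂ₜψ`. [folklore] -/
theorem hasDerivAt_timeSlice {F' : Type*} [NormedAddCommGroup F'] [NormedSpace ℝ F']
    {w : ℝ → UnitAddTorus d → F'} (hw : ContDiff ℝ ∞ (FunctionSpaces.Torus.stLift w)) (t : ℝ) (x : UnitAddTorus d) :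
    HasDerivAt (fun τ => w τ x) (FunctionSpaces.Torus.timeDeriv w t x) t := by
  obtain ⟨y, rfl⟩ := FunctionSpaces.Torus.proj_surjective x
  have : DifferentiableAt ℝ (fun τ : ℝ => w τ (FunctionSpaces.Torus.proj y)) t :=
    ((hw.differentiable (by simp)).comp (differentiable_id.prodMk (differentiable_const y))).differentiableAt
  exact this.hasDerivAt

omit [DecidableEq d] in
/-- **Time derivative of the test component**:
`∂ₜΦ = ∂ₜψ · W + ψ · W' + V'` with `W = stConv ρ K U`, `W' = stConv ρ' K U`, `V' = stConv ρ' K (ψU)`. [folklore] -/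
theorem timeDeriv_drTest (hU : Integrable U ((volume : Measure ℝ).prod volume))
    (hρ : ContDiff ℝ ∞ ρ) (hρc : HasCompactSupport ρ) (hK : FunctionSpaces.Torus.IsSmooth K)
    (hψs : ContDiff ℝ ∞ (FunctionSpaces.Torus.stLift ψ)) (hψb : ∀ t x, |ψ t x| ≤ Cψ) (t : ℝ) (x : UnitAddTorus d) :
    FunctionSpaces.Torus.timeDeriv (drTest ρ K ψ U) t x =
      FunctionSpaces.Torus.timeDeriv ψ t x * FunctionSpaces.Torus.stConv ρ K U t x +
        ψ t x * FunctionSpaces.Torus.stConv (deriv ρ) K U t x +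
        FunctionSpaces.Torus.stConv (deriv ρ) K (fun q => ψ q.1 q.2 * U q) t x := by
  have hψc : Continuous (uncurry ψ) := FunctionSpaces.Torus.continuous_uncurry_of_continuous_stLift hψs.continuous
  have hρ1 : ContDiff ℝ 1 ρ := hρ.of_le (by norm_cast)
  have hK1 : FunctionSpaces.Torus.IsContDiff 1 K := hK.isContDiff (by simp)
  have h1 := hasDerivAt_timeSlice hψs t x
  have h2 := hasDerivAt_stConv_time hU hρ1 hρc hK1 t x
  have h3 := hasDerivAt_stConv_time (integrable_cutoff_mul hU hψc hψb) hρ1 hρc hK1 t x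
  have h := (h1.mul h2).add h3
  exact h.deriv

omit [DecidableEq d] in
/-- Slices of the test component, as functions on the torus. [folklore] -/
theorem drTest_slice_eq (ρ : ℝ → ℝ) (K : UnitAddTorus d → ℝ) (ψ : ℝ → UnitAddTorus d → ℝ)
    (U : ℝ × UnitAddTorus d → ℝ) (t : ℝ) :
    drTest ρ K ψ U t = (fun x => ψ t x * FunctionSpaces.Torus.stConv ρ K U t x) +
      FunctionSpaces.Torus.stConv ρ K (fun q => ψ q.1 q.2 * U q) t := by
  funext x; rfl

/-- **Space derivatives of the test component**:
`∂ᵢΦ = ∂ᵢψ · W + ψ · Wdᵢ + Vdᵢ` with `Wdᵢ = stConv ρ (∂ᵢK) U`, `Vdᵢ = stConv ρ (∂ᵢK) (ψU)`. [folklore] -/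
theorem partialDeriv_drTest (hU : Integrable U ((volume : Measure ℝ).prod volume))
    (hρ : ContDiff ℝ ∞ ρ) (hρc : HasCompactSupport ρ) (hK : FunctionSpaces.Torus.IsSmooth K)
    (hψs : ContDiff ℝ ∞ (FunctionSpaces.Torus.stLift ψ)) (hψb : ∀ t x, |ψ t x| ≤ Cψ) (i : d) (t : ℝ)
    (x : UnitAddTorus d) :
    FunctionSpaces.Torus.partialDeriv i (drTest ρ K ψ U t) x =
      FunctionSpaces.Torus.partialDeriv i (ψ t) x * FunctionSpaces.Torus.stConv ρ K U t x +
        ψ t x * FunctionSpaces.Torus.stConv ρ (FunctionSpaces.Torus.partialDeriv i K) U t x +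
        FunctionSpaces.Torus.stConv ρ (FunctionSpaces.Torus.partialDeriv i K) (fun q => ψ q.1 q.2 * U q) t x := by
  have hψc : Continuous (uncurry ψ) := FunctionSpaces.Torus.continuous_uncurry_of_continuous_stLift hψs.continuous
  have hρ1 : ContDiff ℝ 1 ρ := hρ.of_le (by norm_cast)
  have hK1 : FunctionSpaces.Torus.IsContDiff 1 K := hK.isContDiff (by simp)
  have hΨ := integrable_cutoff_mul hU hψc hψb
  have hWs : FunctionSpaces.Torus.IsSmooth (FunctionSpaces.Torus.stConv ρ K U t) :=
    isSmooth_slice_of_contDiff_stLift (FunctionSpaces.Torus.contDiff_top_stLift_stConv hU hρ hρc hK) t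
  have hVs : FunctionSpaces.Torus.IsSmooth (FunctionSpaces.Torus.stConv ρ K (fun q => ψ q.1 q.2 * U q) t) :=
    isSmooth_slice_of_contDiff_stLift (FunctionSpaces.Torus.contDiff_top_stLift_stConv hΨ hρ hρc hK) t
  have hψt : FunctionSpaces.Torus.IsSmooth (ψ t) := isSmooth_slice_of_contDiff_stLift hψs t
  have hm : FunctionSpaces.Torus.IsContDiff 1 (fun x => ψ t x * FunctionSpaces.Torus.stConv ρ K U t x) :=
    (hψt.smul' hWs).isContDiff (by simp)
  rw [drTest_slice_eq, FunctionSpaces.Torus.partialDeriv_add hm (hVs.isContDiff (by simp)), Pi.add_apply,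
    FunctionSpaces.Torus.partialDeriv_mul (hψt.isContDiff (by simp)) (hWs.isContDiff (by simp)),
    FunctionSpaces.Torus.partialDeriv_stConv hU hρ1 hρc hK1, FunctionSpaces.Torus.partialDeriv_stConv hΨ hρ1 hρc hK1]
  ring

/-- **Second space derivatives of the test component**:
`∂ᵢ∂ᵢΦ = ∂ᵢ∂ᵢψ · W + 2 ∂ᵢψ · Wdᵢ + ψ · Wddᵢ + Vddᵢ`, `Wddᵢ = stConv ρ (∂ᵢ∂ᵢK) U`,
`Vddᵢ = stConv ρ (∂ᵢ∂ᵢK) (ψU)`. [folklore] -/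
theorem partialDeriv_partialDeriv_drTest (hU : Integrable U ((volume : Measure ℝ).prod volume))
    (hρ : ContDiff ℝ ∞ ρ) (hρc : HasCompactSupport ρ) (hK : FunctionSpaces.Torus.IsSmooth K)
    (hψs : ContDiff ℝ ∞ (FunctionSpaces.Torus.stLift ψ)) (hψb : ∀ t x, |ψ t x| ≤ Cψ) (i : d) (t : ℝ)
    (x : UnitAddTorus d) :
    FunctionSpaces.Torus.partialDeriv i (FunctionSpaces.Torus.partialDeriv i (drTest ρ K ψ U t)) x =
      FunctionSpaces.Torus.partialDeriv i (FunctionSpaces.Torus.partialDeriv i (ψ t)) x *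
          FunctionSpaces.Torus.stConv ρ K U t x +
        2 * (FunctionSpaces.Torus.partialDeriv i (ψ t) x *
          FunctionSpaces.Torus.stConv ρ (FunctionSpaces.Torus.partialDeriv i K) U t x) +
        ψ t x * FunctionSpaces.Torus.stConv ρ
          (FunctionSpaces.Torus.partialDeriv i (FunctionSpaces.Torus.partialDeriv i K)) U t x +
        FunctionSpaces.Torus.stConv ρ (FunctionSpaces.Torus.partialDeriv i (FunctionSpaces.Torus.partialDeriv i K))
          (fun q => ψ q.1 q.2 * U q) t x := by
  have hψc : Continuous (uncurry ψ) := FunctionSpaces.Torus.continuous_uncurry_of_continuous_stLift hψs.continuous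
  have hρ1 : ContDiff ℝ 1 ρ := hρ.of_le (by norm_cast)
  have hKi : FunctionSpaces.Torus.IsSmooth (FunctionSpaces.Torus.partialDeriv i K) := hK.partialDeriv i
  have hKi1 : FunctionSpaces.Torus.IsContDiff 1 (FunctionSpaces.Torus.partialDeriv i K) := hKi.isContDiff (by simp)
  have hΨ := integrable_cutoff_mul hU hψc hψb
  -- the first derivative, as a function on the torus
  have h1 : FunctionSpaces.Torus.partialDeriv i (drTest ρ K ψ U t) =
      (fun x => FunctionSpaces.Torus.partialDeriv i (ψ t) x * FunctionSpaces.Torus.stConv ρ K U t x +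
        ψ t x * FunctionSpaces.Torus.stConv ρ (FunctionSpaces.Torus.partialDeriv i K) U t x) +
        FunctionSpaces.Torus.stConv ρ (FunctionSpaces.Torus.partialDeriv i K) (fun q => ψ q.1 q.2 * U q) t := by
    funext y
    rw [Pi.add_apply, partialDeriv_drTest hU hρ hρc hK hψs hψb i t y]
  -- smoothness of the pieces
  have hWs : FunctionSpaces.Torus.IsSmooth (FunctionSpaces.Torus.stConv ρ K U t) :=
    isSmooth_slice_of_contDiff_stLift (FunctionSpaces.Torus.contDiff_top_stLift_stConv hU hρ hρc hK) t
  have hWds : FunctionSpaces.Torus.IsSmooth (FunctionSpaces.Torus.stConv ρ (FunctionSpaces.Torus.partialDeriv i K) U t) :=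
    isSmooth_slice_of_contDiff_stLift (FunctionSpaces.Torus.contDiff_top_stLift_stConv hU hρ hρc hKi) t
  have hVds : FunctionSpaces.Torus.IsSmooth
      (FunctionSpaces.Torus.stConv ρ (FunctionSpaces.Torus.partialDeriv i K) (fun q => ψ q.1 q.2 * U q) t) :=
    isSmooth_slice_of_contDiff_stLift (FunctionSpaces.Torus.contDiff_top_stLift_stConv hΨ hρ hρc hKi) t
  have hψt : FunctionSpaces.Torus.IsSmooth (ψ t) := isSmooth_slice_of_contDiff_stLift hψs t
  have hψti : FunctionSpaces.Torus.IsSmooth (FunctionSpaces.Torus.partialDeriv i (ψ t)) := hψt.partialDeriv i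
  have hA : FunctionSpaces.Torus.IsContDiff 1
      (fun x => FunctionSpaces.Torus.partialDeriv i (ψ t) x * FunctionSpaces.Torus.stConv ρ K U t x) :=
    (hψti.smul' hWs).isContDiff (by simp)
  have hB : FunctionSpaces.Torus.IsContDiff 1
      (fun x => ψ t x * FunctionSpaces.Torus.stConv ρ (FunctionSpaces.Torus.partialDeriv i K) U t x) :=
    (hψt.smul' hWds).isContDiff (by simp)
  have hAB : FunctionSpaces.Torus.IsContDiff 1
      (fun x => FunctionSpaces.Torus.partialDeriv i (ψ t) x * FunctionSpaces.Torus.stConv ρ K U t x +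
        ψ t x * FunctionSpaces.Torus.stConv ρ (FunctionSpaces.Torus.partialDeriv i K) U t x) := hA.add hB
  have hAB' : (fun x => FunctionSpaces.Torus.partialDeriv i (ψ t) x * FunctionSpaces.Torus.stConv ρ K U t x +
        ψ t x * FunctionSpaces.Torus.stConv ρ (FunctionSpaces.Torus.partialDeriv i K) U t x) =
      (fun x => FunctionSpaces.Torus.partialDeriv i (ψ t) x * FunctionSpaces.Torus.stConv ρ K U t x) +
        fun x => ψ t x * FunctionSpaces.Torus.stConv ρ (FunctionSpaces.Torus.partialDeriv i K) U t x := by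
    funext y; rfl
  rw [h1, FunctionSpaces.Torus.partialDeriv_add hAB (hVds.isContDiff (by simp)), Pi.add_apply, hAB',
    FunctionSpaces.Torus.partialDeriv_add hA hB, Pi.add_apply,
    FunctionSpaces.Torus.partialDeriv_mul (hψti.isContDiff (by simp)) (hWs.isContDiff (by simp)),
    FunctionSpaces.Torus.partialDeriv_mul (hψt.isContDiff (by simp)) (hWds.isContDiff (by simp)),
    FunctionSpaces.Torus.partialDeriv_stConv hU hρ1 hρc (hK.isContDiff (by simp)),
    FunctionSpaces.Torus.partialDeriv_stConv hU hρ1 hρc hKi1,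
    FunctionSpaces.Torus.partialDeriv_stConv hΨ hρ1 hρc hKi1]
  ring

/-- **Laplacian of the test component**:
`ΔΦ = Δψ · W + 2 ∑ᵢ ∂ᵢψ · Wdᵢ + ψ · ∑ᵢ Wddᵢ + ∑ᵢ Vddᵢ`. [folklore] -/
theorem laplacian_drTest (hU : Integrable U ((volume : Measure ℝ).prod volume))
    (hρ : ContDiff ℝ ∞ ρ) (hρc : HasCompactSupport ρ) (hK : FunctionSpaces.Torus.IsSmooth K)
    (hψs : ContDiff ℝ ∞ (FunctionSpaces.Torus.stLift ψ)) (hψb : ∀ t x, |ψ t x| ≤ Cψ) (t : ℝ)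
    (x : UnitAddTorus d) :
    FunctionSpaces.Torus.laplacian (drTest ρ K ψ U t) x =
      FunctionSpaces.Torus.laplacian (ψ t) x * FunctionSpaces.Torus.stConv ρ K U t x +
        2 * ∑ i, FunctionSpaces.Torus.partialDeriv i (ψ t) x *
          FunctionSpaces.Torus.stConv ρ (FunctionSpaces.Torus.partialDeriv i K) U t x +
        ψ t x * ∑ i, FunctionSpaces.Torus.stConv ρ
          (FunctionSpaces.Torus.partialDeriv i (FunctionSpaces.Torus.partialDeriv i K)) U t x +
        ∑ i, FunctionSpaces.Torus.stConv ρ (FunctionSpaces.Torus.partialDeriv i (FunctionSpaces.Torus.partialDeriv i K))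
          (fun q => ψ q.1 q.2 * U q) t x := by
  have hs : FunctionSpaces.Torus.IsSmooth (drTest ρ K ψ U t) :=
    isSmooth_slice_of_contDiff_stLift (contDiff_stLift_drTest hU hρ hρc hK hψs hψb) t
  have hψt : FunctionSpaces.Torus.IsSmooth (ψ t) := isSmooth_slice_of_contDiff_stLift hψs t
  rw [FunctionSpaces.Torus.laplacian_eq_sum_partialDeriv_partialDeriv hs,
    FunctionSpaces.Torus.laplacian_eq_sum_partialDeriv_partialDeriv hψt]
  simp_rw [partialDeriv_partialDeriv_drTest hU hρ hρc hK hψs hψb]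
  rw [Finset.sum_add_distrib, Finset.sum_add_distrib, Finset.sum_add_distrib, Finset.sum_mul, Finset.mul_sum,
    Finset.mul_sum]

end DRTest

/-! ## The exact time-derivative pairing of the test component -/

section TimePairing

variable [DecidableEq d]
variable {ρ : ℝ → ℝ} {K : UnitAddTorus d → ℝ} {ψ : ℝ → UnitAddTorus d → ℝ} {U : ℝ × UnitAddTorus d → ℝ}
  {Cψ Cψ' : ℝ}

omit [DecidableEq d] in
/-- **The time-derivative pairing collapses** (the symmetric structure of Duchon–Robert's field):
for even `ρ`, `K`, `∫ U ∂ₜΦ = ∫ U ∂ₜψ W` with `W = stConv ρ K U` — the two terms `∫ U ψ W'` and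
`∫ U V'` (`W' = stConv ρ' K U`, `V' = stConv ρ' K (ψU)`) cancel by the odd–even duality
`∫ U · stConv ρ' K (ψU) = -∫ (ψU) · stConv ρ' K U` (`Torus.integral_mul_stConv_odd_even`). This is the
weak form of `u·∂ₜu^ε + u^ε·∂ₜu = ∂ₜ(u·u^ε)` moved onto `ψ`. [folklore] -/
theorem integral_mul_timeDeriv_drTest (hU : Integrable U ((volume : Measure ℝ).prod volume))
    (hρ : ContDiff ℝ ∞ ρ) (hρc : HasCompactSupport ρ) (hρeven : ∀ r, ρ (-r) = ρ r)
    (hK : FunctionSpaces.Torus.IsSmooth K) (hKeven : ∀ z, K (-z) = K z)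
    (hψs : ContDiff ℝ ∞ (FunctionSpaces.Torus.stLift ψ)) (hψb : ∀ t x, |ψ t x| ≤ Cψ)
    (hψ'c : Continuous (uncurry (FunctionSpaces.Torus.timeDeriv ψ)))
    (hψ'b : ∀ t x, |FunctionSpaces.Torus.timeDeriv ψ t x| ≤ Cψ') :
    ∫ q, U q * FunctionSpaces.Torus.timeDeriv (drTest ρ K ψ U) q.1 q.2 ∂((volume : Measure ℝ).prod volume) =
      ∫ q, U q * (FunctionSpaces.Torus.timeDeriv ψ q.1 q.2 * FunctionSpaces.Torus.stConv ρ K U q.1 q.2)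
        ∂((volume : Measure ℝ).prod volume) := by
  set μ : Measure (ℝ × UnitAddTorus d) := (volume : Measure ℝ).prod volume with hμ
  have hψc : Continuous (uncurry ψ) := FunctionSpaces.Torus.continuous_uncurry_of_continuous_stLift hψs.continuous
  have hΨ : Integrable (fun q : ℝ × UnitAddTorus d => ψ q.1 q.2 * U q) μ := integrable_cutoff_mul hU hψc hψb
  have hρ' : ContDiff ℝ ∞ (deriv ρ) := hρ.deriv'
  have hρ'c : Continuous (deriv ρ) := hρ.continuous_deriv (by simp)
  -- the three mollified fields and their bounds / continuity
  set W : ℝ → UnitAddTorus d → ℝ := FunctionSpaces.Torus.stConv ρ K U with hW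
  set W' : ℝ → UnitAddTorus d → ℝ := FunctionSpaces.Torus.stConv (deriv ρ) K U with hW'
  set V' : ℝ → UnitAddTorus d → ℝ := FunctionSpaces.Torus.stConv (deriv ρ) K (fun q => ψ q.1 q.2 * U q) with hV'
  obtain ⟨M₀, hM₀⟩ := exists_abs_stConv_le hU hρ.continuous hρc hK.continuous
  obtain ⟨M₁, hM₁⟩ := exists_abs_stConv_le hU hρ'c hρc.deriv hK.continuous
  obtain ⟨M₂, hM₂⟩ := exists_abs_stConv_le hΨ hρ'c hρc.deriv hK.continuous
  have hWc : Continuous (uncurry W) := FunctionSpaces.Torus.continuous_uncurry_of_continuous_stLift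
    (FunctionSpaces.Torus.contDiff_top_stLift_stConv hU hρ hρc hK).continuous
  have hW'c : Continuous (uncurry W') := FunctionSpaces.Torus.continuous_uncurry_of_continuous_stLift
    (FunctionSpaces.Torus.contDiff_top_stLift_stConv hU hρ' hρc.deriv hK).continuous
  have hV'c : Continuous (uncurry V') := FunctionSpaces.Torus.continuous_uncurry_of_continuous_stLift
    (FunctionSpaces.Torus.contDiff_top_stLift_stConv hΨ hρ' hρc.deriv hK).continuous
  -- integrability of the three pairings
  have I1 : Integrable (fun q : ℝ × UnitAddTorus d => U q * (FunctionSpaces.Torus.timeDeriv ψ q.1 q.2 * W q.1 q.2)) μ :=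
    hU.mul_bdd (c := Cψ' * M₀) (hψ'c.mul hWc).aestronglyMeasurable (Eventually.of_forall fun q => by
      rw [norm_mul, Real.norm_eq_abs, Real.norm_eq_abs]
      exact mul_le_mul (hψ'b _ _) (hM₀ _ _) (abs_nonneg _) ((abs_nonneg _).trans (hψ'b 0 0)))
  have I2 : Integrable (fun q : ℝ × UnitAddTorus d => ψ q.1 q.2 * U q * W' q.1 q.2) μ :=
    hΨ.mul_bdd (c := M₁) hW'c.aestronglyMeasurable (Eventually.of_forall fun q => by
      rw [Real.norm_eq_abs]; exact hM₁ _ _)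
  have I3 : Integrable (fun q : ℝ × UnitAddTorus d => U q * V' q.1 q.2) μ :=
    hU.mul_bdd (c := M₂) hV'c.aestronglyMeasurable (Eventually.of_forall fun q => by
      rw [Real.norm_eq_abs]; exact hM₂ _ _)
  -- expand the time derivative
  have hexp : (fun q : ℝ × UnitAddTorus d => U q * FunctionSpaces.Torus.timeDeriv (drTest ρ K ψ U) q.1 q.2) =
      fun q => U q * (FunctionSpaces.Torus.timeDeriv ψ q.1 q.2 * W q.1 q.2) +
        (ψ q.1 q.2 * U q * W' q.1 q.2 + U q * V' q.1 q.2) := by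
    funext q
    rw [timeDeriv_drTest hU hρ hρc hK hψs hψb q.1 q.2]
    ring
  have I23 : Integrable (fun q : ℝ × UnitAddTorus d => ψ q.1 q.2 * U q * W' q.1 q.2 + U q * V' q.1 q.2) μ := I2.add I3
  rw [hexp, integral_add I1 I23, integral_add I2 I3]
  -- the cancellation
  have hdual : ∫ q, U q * V' q.1 q.2 ∂μ = -∫ q, ψ q.1 q.2 * U q * W' q.1 q.2 ∂μ := by
    rw [hV', integral_mul_stConv_odd_even hU hΨ hρ'c hρc.deriv (FunctionSpaces.deriv_neg_of_even hρeven)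
      hK.continuous hKeven]
  rw [hdual, add_neg_cancel, add_zero]

end TimePairing

/-! ## The weak formulation tested with a component vector field, read on `ℝ × T^d` -/

section WeakForm

variable [DecidableEq d] {T ν : ℝ} {u : ℝ → UnitAddTorus d → EuclideanSpace ℝ d} {p : ℝ → UnitAddTorus d → ℝ}
  {Uc : d → ℝ × UnitAddTorus d → ℝ} {φc : d → ℝ → UnitAddTorus d → ℝ}

/-- The pressure on `(0,T) × T^d`, extended by zero to `ℝ × T^d`. [folklore] -/
def stBarScalar (T : ℝ) (p : ℝ → UnitAddTorus d → ℝ) : ℝ × UnitAddTorus d → ℝ :=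
  (Ioo 0 T ×ˢ (univ : Set (UnitAddTorus d))).indicator (uncurry p)

omit [Fintype d] [DecidableEq d] in
/-- On `(0,T)` the extension agrees with the pressure. [folklore] -/
theorem stBarScalar_apply_of_mem [Fintype d] {t : ℝ} (ht : t ∈ Ioo 0 T) (x : UnitAddTorus d) :
    stBarScalar T p (t, x) = p t x := by
  simp [stBarScalar, indicator_of_mem (show (t, x) ∈ Ioo 0 T ×ˢ (univ : Set (UnitAddTorus d)) from
    ⟨ht, mem_univ _⟩)]

omit [Fintype d] [DecidableEq d] in
/-- Off `(0,T)` the extension vanishes. [folklore] -/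
theorem stBarScalar_apply_of_not_mem [Fintype d] {t : ℝ} (ht : t ∉ Ioo 0 T) (x : UnitAddTorus d) :
    stBarScalar T p (t, x) = 0 := by
  simp [stBarScalar, indicator_of_notMem (show (t, x) ∉ Ioo 0 T ×ˢ (univ : Set (UnitAddTorus d)) from
    fun h => ht h.1)]

omit [DecidableEq d] in
/-- The extended pressure is integrable on `ℝ × T^d` for `p ∈ L¹((0,T) × T^d)`. [folklore] -/
theorem integrable_stBarScalar
    (hpm : AEStronglyMeasurable (FunctionSpaces.Torus.stLift p) (volume.restrict (Ioo 0 T ×ˢ univ)))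
    (hp1 : ∫⁻ t in Ioo 0 T, ∫⁻ x, ‖p t x‖ₑ < ⊤) :
    Integrable (stBarScalar T p) ((volume : Measure ℝ).prod volume) := by
  have hm : AEStronglyMeasurable (uncurry p) ((volume.restrict (Ioo 0 T)).prod volume) :=
    aestronglyMeasurable_uncurry_prod hpm
  rw [stBarScalar, integrable_indicator_iff (measurableSet_Ioo.prod MeasurableSet.univ), IntegrableOn,
    ← Measure.restrict_prod_eq_prod_univ]
  refine ⟨hm, ?_⟩
  have e : ∫⁻ t in Ioo 0 T, ∫⁻ x, ‖p t x‖ₑ = ∫⁻ z, ‖p z.1 z.2‖ₑ ∂((volume.restrict (Ioo 0 T)).prod volume) :=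
    lintegral_Ioo_lintegral_eq_lintegral_prod hm.enorm
  rw [e] at hp1
  exact hp1

omit [DecidableEq d] in
/-- The extended pressure is in `L^{3/2}(ℝ × T^d)` for `p ∈ L^{3/2}((0,T) × T^d)`. [folklore] -/
theorem memLp_stBarScalar
    (hpm : AEStronglyMeasurable (FunctionSpaces.Torus.stLift p) (volume.restrict (Ioo 0 T ×ˢ univ)))
    (hp : ∫⁻ t in Ioo 0 T, ∫⁻ x, ‖p t x‖ₑ ^ (3 / 2 : ℝ) < ⊤) :
    MemLp (stBarScalar T p) (3 / 2) ((volume : Measure ℝ).prod volume) := by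
  have hm : AEStronglyMeasurable (uncurry p) ((volume.restrict (Ioo 0 T)).prod volume) :=
    aestronglyMeasurable_uncurry_prod hpm
  rw [stBarScalar, memLp_indicator_iff_restrict (measurableSet_Ioo.prod MeasurableSet.univ),
    ← Measure.restrict_prod_eq_prod_univ]
  refine ⟨hm, ?_⟩
  have h32 : ((3 / 2 : ℝ≥0∞)).toReal = (3 / 2 : ℝ) := by
    rw [ENNReal.toReal_div, ENNReal.toReal_ofNat, ENNReal.toReal_ofNat]
  rw [eLpNorm_eq_lintegral_rpow_enorm_toReal (by norm_num) (ENNReal.div_ne_top ENNReal.ofNat_ne_top (by norm_num)), h32]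
  refine ENNReal.rpow_lt_top_of_nonneg (by positivity) (ne_of_lt ?_)
  have e : ∫⁻ t in Ioo 0 T, ∫⁻ x, ‖p t x‖ₑ ^ (3 / 2 : ℝ) =
      ∫⁻ z, ‖p z.1 z.2‖ₑ ^ (3 / 2 : ℝ) ∂((volume.restrict (Ioo 0 T)).prod volume) :=
    lintegral_Ioo_lintegral_eq_lintegral_prod (hm.enorm.pow_const _)
  rw [e] at hp
  exact hp

/-- **The distributional Navier–Stokes identity, tested with a vector field of smooth bounded
components, read on `ℝ × T^d` against the extended velocity and pressure.** If
`Φ = vecField φc` is an admissible test field with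
`∫₀ᵀ∫ (⟪u, ∂ₜΦ⟫ + ⟪u, (u·∇)Φ⟫ + ν⟪u, ΔΦ⟫ + p div Φ + ⟪0, Φ⟫) = 0`, the components `φc j` being
smooth with bounded, jointly continuous `∂ₜΦⱼ`, `∂ᵢΦⱼ`, `ΔΦⱼ`, then for the strongly measurable
representatives `Uⱼ` of the components of `ū = 𝟙_{(0,T)} u` and the extended pressure `p̄`:
`∑ⱼ ∫ Uⱼ ∂ₜΦⱼ + ∑ⱼᵢ ∫ Uⱼ Uᵢ ∂ᵢΦⱼ + ν ∑ⱼ ∫ Uⱼ ΔΦⱼ + ∫ p̄ ∑ᵢ ∂ᵢΦᵢ = 0` (integrals over `ℝ × T^d`;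
the four-term version of `Torus.weakForm_rewrite`). [folklore] -/
theorem weakForm_rewrite_pressure
    (hweak : ∫ t in Ioo 0 T, ∫ x, (⟪u t x, FunctionSpaces.Torus.timeDeriv (vecField φc) t x⟫ +
      ⟪u t x, FunctionSpaces.Torus.convect (u t) (vecField φc t) x⟫ +
        ν * ⟪u t x, FunctionSpaces.Torus.laplacian (vecField φc t) x⟫ +
        p t x * FunctionSpaces.Torus.divergence (vecField φc t) x +
        ⟪(0 : ℝ → UnitAddTorus d → EuclideanSpace ℝ d) t x, vecField φc t x⟫) = 0)
    (hψs : ∀ j, ContDiff ℝ ∞ (FunctionSpaces.Torus.stLift (φc j)))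
    (hdtc : ∀ j, Continuous (uncurry (FunctionSpaces.Torus.timeDeriv (φc j))))
    (hdxc : ∀ j i, Continuous (uncurry fun t x => FunctionSpaces.Torus.partialDeriv i (φc j t) x))
    (hdLc : ∀ j, Continuous (uncurry fun t x => FunctionSpaces.Torus.laplacian (φc j t) x))
    (hdtb : ∀ j, ∃ C, ∀ t x, |FunctionSpaces.Torus.timeDeriv (φc j) t x| ≤ C)
    (hdxb : ∀ j i, ∃ C, ∀ t x, |FunctionSpaces.Torus.partialDeriv i (φc j t) x| ≤ C)
    (hdLb : ∀ j, ∃ C, ∀ t x, |FunctionSpaces.Torus.laplacian (φc j t) x| ≤ C)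
    (hbar1 : Integrable (stBar T u) ((volume : Measure ℝ).prod volume))
    (hbar2 : MemLp (stBar T u) 2 ((volume : Measure ℝ).prod volume))
    (hpbar : Integrable (stBarScalar T p) ((volume : Measure ℝ).prod volume))
    (hUc : ∀ j, Uc j =ᵐ[(volume : Measure ℝ).prod volume] fun q => stBar T u q j) :
    ∑ j, ∫ q, Uc j q * FunctionSpaces.Torus.timeDeriv (φc j) q.1 q.2 ∂((volume : Measure ℝ).prod volume) +
      ∑ j, ∑ i, ∫ q, Uc j q * Uc i q * FunctionSpaces.Torus.partialDeriv i (φc j q.1) q.2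
        ∂((volume : Measure ℝ).prod volume) +
      ν * ∑ j, ∫ q, Uc j q * FunctionSpaces.Torus.laplacian (φc j q.1) q.2 ∂((volume : Measure ℝ).prod volume) +
      ∫ q, stBarScalar T p q * ∑ i, FunctionSpaces.Torus.partialDeriv i (φc i q.1) q.2
        ∂((volume : Measure ℝ).prod volume) = 0 := by
  set μ : Measure (ℝ × UnitAddTorus d) := (volume : Measure ℝ).prod volume with hμ
  -- (a) the integrand, componentwise
  have hslice : ∀ j t, FunctionSpaces.Torus.IsSmooth (φc j t) := fun j t => isSmooth_slice_of_contDiff_stLift (hψs j) t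
  have hdiff : ∀ t x j, DifferentiableAt ℝ (fun τ => φc j τ x) t := fun t x j =>
    (hasDerivAt_timeSlice (hψs j) t x).differentiableAt
  have hdiv : ∀ t x, FunctionSpaces.Torus.divergence (vecField φc t) x = ∑ i, FunctionSpaces.Torus.partialDeriv i (φc i t) x := by
    intro t x
    rfl
  have hpt : ∀ t x, ⟪u t x, FunctionSpaces.Torus.timeDeriv (vecField φc) t x⟫ +
      ⟪u t x, FunctionSpaces.Torus.convect (u t) (vecField φc t) x⟫ +
        ν * ⟪u t x, FunctionSpaces.Torus.laplacian (vecField φc t) x⟫ +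
        p t x * FunctionSpaces.Torus.divergence (vecField φc t) x +
        ⟪(0 : ℝ → UnitAddTorus d → EuclideanSpace ℝ d) t x, vecField φc t x⟫ =
      ∑ j, u t x j * FunctionSpaces.Torus.timeDeriv (φc j) t x +
        ∑ j, ∑ i, u t x j * u t x i * FunctionSpaces.Torus.partialDeriv i (φc j t) x +
        ν * ∑ j, u t x j * FunctionSpaces.Torus.laplacian (φc j t) x +
        p t x * ∑ i, FunctionSpaces.Torus.partialDeriv i (φc i t) x := by
    intro t x
    rw [Pi.zero_apply, Pi.zero_apply, inner_zero_left, add_zero, inner_timeDeriv_vecField (hdiff t x),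
      inner_convect_vecField (fun j => (hslice j t).isContDiff (by simp)),
      inner_laplacian_vecField (fun j => hslice j t), hdiv]
    congr 3
    refine Finset.sum_congr rfl fun j _ => ?_
    rw [Finset.mul_sum]
    refine Finset.sum_congr rfl fun i _ => ?_
    ring
  -- (b) the same expression with the extended fields, on `ℝ × T^d`
  set Fb : ℝ × UnitAddTorus d → ℝ := fun q =>
    ∑ j, stBar T u q j * FunctionSpaces.Torus.timeDeriv (φc j) q.1 q.2 +
      ∑ j, ∑ i, stBar T u q j * stBar T u q i * FunctionSpaces.Torus.partialDeriv i (φc j q.1) q.2 +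
      ν * ∑ j, stBar T u q j * FunctionSpaces.Torus.laplacian (φc j q.1) q.2 +
      stBarScalar T p q * ∑ i, FunctionSpaces.Torus.partialDeriv i (φc i q.1) q.2 with hFb
  have hbarj : ∀ j, Integrable (fun q => stBar T u q j) μ := fun j =>
    (EuclideanSpace.proj (𝕜 := ℝ) j).integrable_comp hbar1
  have hbarj2 : ∀ j, MemLp (fun q => stBar T u q j) 2 μ := fun j => hbar2.eval_piLp j
  have hdtm : ∀ j, AEStronglyMeasurable (fun q : ℝ × UnitAddTorus d => FunctionSpaces.Torus.timeDeriv (φc j) q.1 q.2) μ :=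
    fun j => (hdtc j).aestronglyMeasurable
  have hdxm : ∀ j i, AEStronglyMeasurable
      (fun q : ℝ × UnitAddTorus d => FunctionSpaces.Torus.partialDeriv i (φc j q.1) q.2) μ := fun j i => (hdxc j i).aestronglyMeasurable
  have hdLm : ∀ j, AEStronglyMeasurable
      (fun q : ℝ × UnitAddTorus d => FunctionSpaces.Torus.laplacian (φc j q.1) q.2) μ := fun j => (hdLc j).aestronglyMeasurable
  have hA : ∀ j, Integrable (fun q => stBar T u q j * FunctionSpaces.Torus.timeDeriv (φc j) q.1 q.2) μ := fun j => by
    obtain ⟨C, hC⟩ := hdtb j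
    exact (hbarj j).mul_bdd (hdtm j) (Eventually.of_forall fun q => by rw [Real.norm_eq_abs]; exact hC _ _)
  have hB : ∀ j i, Integrable (fun q => stBar T u q j * stBar T u q i * FunctionSpaces.Torus.partialDeriv i (φc j q.1) q.2) μ :=
    fun j i => by
    obtain ⟨C, hC⟩ := hdxb j i
    exact ((hbarj2 j).integrable_mul (hbarj2 i)).mul_bdd (hdxm j i)
      (Eventually.of_forall fun q => by rw [Real.norm_eq_abs]; exact hC _ _)
  have hL : ∀ j, Integrable (fun q => stBar T u q j * FunctionSpaces.Torus.laplacian (φc j q.1) q.2) μ := fun j => by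
    obtain ⟨C, hC⟩ := hdLb j
    exact (hbarj j).mul_bdd (hdLm j) (Eventually.of_forall fun q => by rw [Real.norm_eq_abs]; exact hC _ _)
  have hsumb : ∃ C, ∀ q : ℝ × UnitAddTorus d, |∑ i, FunctionSpaces.Torus.partialDeriv i (φc i q.1) q.2| ≤ C := by
    choose C hC using fun i => hdxb i i
    refine ⟨∑ i, C i, fun q => (Finset.abs_sum_le_sum_abs _ _).trans (Finset.sum_le_sum fun i _ => hC i _ _)⟩
  have hP : Integrable (fun q => stBarScalar T p q * ∑ i, FunctionSpaces.Torus.partialDeriv i (φc i q.1) q.2) μ := by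
    obtain ⟨C, hC⟩ := hsumb
    refine hpbar.mul_bdd (Finset.aestronglyMeasurable_fun_sum _ fun i _ => hdxm i i)
      (Eventually.of_forall fun q => by rw [Real.norm_eq_abs]; exact hC q)
  have hFbi : Integrable Fb μ :=
    (((integrable_finsetSum _ fun j _ => hA j).add
      (integrable_finsetSum _ fun j _ => integrable_finsetSum _ fun i _ => hB j i)).add
      ((integrable_finsetSum _ fun j _ => hL j).const_mul ν)).add hP
  -- (c) from the weak identity to `∫ Fb = 0`
  have hzero : ∫ q, Fb q ∂μ = 0 := by
    rw [integral_prod _ hFbi]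
    have h1 : ∫ t, ∫ x, Fb (t, x) = ∫ t in Ioo 0 T, ∫ x, Fb (t, x) := by
      refine (setIntegral_eq_integral_of_forall_compl_eq_zero fun t ht => ?_).symm
      have : (fun x => Fb (t, x)) = fun _ => 0 := by
        funext x
        simp [hFb, stBar_apply_of_not_mem ht, stBarScalar_apply_of_not_mem ht]
      rw [this, integral_zero]
    rw [h1]
    have h2 : ∫ t in Ioo 0 T, ∫ x, Fb (t, x) = ∫ t in Ioo 0 T, ∫ x, (⟪u t x, FunctionSpaces.Torus.timeDeriv (vecField φc) t x⟫ +
      ⟪u t x, FunctionSpaces.Torus.convect (u t) (vecField φc t) x⟫ +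
        ν * ⟪u t x, FunctionSpaces.Torus.laplacian (vecField φc t) x⟫ +
        p t x * FunctionSpaces.Torus.divergence (vecField φc t) x +
        ⟪(0 : ℝ → UnitAddTorus d → EuclideanSpace ℝ d) t x, vecField φc t x⟫) := by
      refine setIntegral_congr_fun measurableSet_Ioo fun t ht => ?_
      refine integral_congr_ae (Eventually.of_forall fun x => ?_)
      beta_reduce
      rw [hpt t x]
      simp [hFb, stBar_apply_of_mem ht, stBarScalar_apply_of_mem ht]
    rw [h2]
    exact hweak
  -- (d) replace the extended field by its representatives and split
  have hae : ∀ᵐ q ∂μ, ∀ j, Uc j q = stBar T u q j := ae_all_iff.2 fun j => hUc j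
  have hA' : ∀ j, Integrable (fun q => Uc j q * FunctionSpaces.Torus.timeDeriv (φc j) q.1 q.2) μ := fun j =>
    (hA j).congr (hae.mono fun q hq => by simp only [hq j])
  have hB' : ∀ j i, Integrable (fun q => Uc j q * Uc i q * FunctionSpaces.Torus.partialDeriv i (φc j q.1) q.2) μ :=
    fun j i => (hB j i).congr (hae.mono fun q hq => by simp only [hq j, hq i])
  have hL' : ∀ j, Integrable (fun q => Uc j q * FunctionSpaces.Torus.laplacian (φc j q.1) q.2) μ := fun j =>
    (hL j).congr (hae.mono fun q hq => by simp only [hq j])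
  have hFb' : ∫ q, Fb q ∂μ = ∫ q, (∑ j, Uc j q * FunctionSpaces.Torus.timeDeriv (φc j) q.1 q.2 +
      ∑ j, ∑ i, Uc j q * Uc i q * FunctionSpaces.Torus.partialDeriv i (φc j q.1) q.2 +
      ν * ∑ j, Uc j q * FunctionSpaces.Torus.laplacian (φc j q.1) q.2 +
      stBarScalar T p q * ∑ i, FunctionSpaces.Torus.partialDeriv i (φc i q.1) q.2) ∂μ := by
    refine integral_congr_ae (hae.mono fun q hq => ?_)
    simp only [hFb, hq]
  rw [hzero] at hFb'
  have hInt1 : Integrable (fun q => ∑ j, Uc j q * FunctionSpaces.Torus.timeDeriv (φc j) q.1 q.2) μ :=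
    integrable_finsetSum _ fun j _ => hA' j
  have hInt2 : Integrable (fun q => ∑ j, ∑ i, Uc j q * Uc i q * FunctionSpaces.Torus.partialDeriv i (φc j q.1) q.2) μ :=
    integrable_finsetSum _ fun j _ => integrable_finsetSum _ fun i _ => hB' j i
  have hInt3 : Integrable (fun q => ν * ∑ j, Uc j q * FunctionSpaces.Torus.laplacian (φc j q.1) q.2) μ :=
    (integrable_finsetSum _ fun j _ => hL' j).const_mul ν
  have hS12 : Integrable (fun q => ∑ j, Uc j q * FunctionSpaces.Torus.timeDeriv (φc j) q.1 q.2 +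
      ∑ j, ∑ i, Uc j q * Uc i q * FunctionSpaces.Torus.partialDeriv i (φc j q.1) q.2) μ := hInt1.add hInt2
  have hS123 : Integrable (fun q => ∑ j, Uc j q * FunctionSpaces.Torus.timeDeriv (φc j) q.1 q.2 +
      ∑ j, ∑ i, Uc j q * Uc i q * FunctionSpaces.Torus.partialDeriv i (φc j q.1) q.2 +
      ν * ∑ j, Uc j q * FunctionSpaces.Torus.laplacian (φc j q.1) q.2) μ := hS12.add hInt3
  rw [integral_add hS123 hP, integral_add hS12 hInt3,
    integral_add hInt1 hInt2, integral_const_mul, integral_finsetSum _ fun j _ => hA' j,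
    integral_finsetSum _ fun j _ => integrable_finsetSum _ fun i _ => hB' j i,
    integral_finsetSum _ fun j _ => hL' j] at hFb'
  simp_rw [integral_finsetSum _ fun i _ => hB' _ i] at hFb'
  exact hFb'.symm

end WeakForm

/-! ## The derivatives of Duchon–Robert's symmetric field on a time slice, through `vⱼ ⋆ ∂K` -/

section SliceFormulas

variable [DecidableEq d] {K χ : UnitAddTorus d → ℝ} {v : UnitAddTorus d → EuclideanSpace ℝ d}

/-- First derivatives of the components of the symmetric field, derivatives on the kernel:
`∂ᵢΦⱼ = ∂ᵢχ (vⱼ ⋆ K) + χ (vⱼ ⋆ ∂ᵢK) + (χvⱼ) ⋆ ∂ᵢK`. [folklore] -/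
theorem partialDeriv_symmTestField_kernel (hK : FunctionSpaces.Torus.IsSmooth K)
    (hχ : FunctionSpaces.Torus.IsSmooth χ) (hv : Integrable v volume) (i j : d) (x : UnitAddTorus d) :
    FunctionSpaces.Torus.partialDeriv i (fun y => symmTestField K χ v y j) x =
      FunctionSpaces.Torus.partialDeriv i χ x * ((fun z => v z j) ⋆ K) x +
        χ x * ((fun z => v z j) ⋆ FunctionSpaces.Torus.partialDeriv i K) x +
        ((fun z => χ z * v z j) ⋆ FunctionSpaces.Torus.partialDeriv i K) x := by
  have hvj : Integrable (fun z => v z j) volume := hv.eval_piLp j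
  have hχvj : Integrable (fun z => χ z * v z j) volume := hχ.integrable_smul hvj
  rw [partialDeriv_symmTestField hK hχ hv i j x, FunctionSpaces.Torus.partialDeriv_convolution hvj hK,
    FunctionSpaces.Torus.partialDeriv_convolution hχvj hK]

/-- Second derivatives of the components of the symmetric field:
`∂ᵢ∂ᵢΦⱼ = ∂ᵢ∂ᵢχ (vⱼ ⋆ K) + 2 ∂ᵢχ (vⱼ ⋆ ∂ᵢK) + χ (vⱼ ⋆ ∂ᵢ∂ᵢK) + (χvⱼ) ⋆ ∂ᵢ∂ᵢK`. [folklore] -/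
theorem partialDeriv_partialDeriv_symmTestField (hK : FunctionSpaces.Torus.IsSmooth K)
    (hχ : FunctionSpaces.Torus.IsSmooth χ) (hv : Integrable v volume) (i j : d) (x : UnitAddTorus d) :
    FunctionSpaces.Torus.partialDeriv i (FunctionSpaces.Torus.partialDeriv i (fun y => symmTestField K χ v y j)) x =
      FunctionSpaces.Torus.partialDeriv i (FunctionSpaces.Torus.partialDeriv i χ) x * ((fun z => v z j) ⋆ K) x +
        2 * (FunctionSpaces.Torus.partialDeriv i χ x * ((fun z => v z j) ⋆ FunctionSpaces.Torus.partialDeriv i K) x) +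
        χ x * ((fun z => v z j) ⋆ FunctionSpaces.Torus.partialDeriv i (FunctionSpaces.Torus.partialDeriv i K)) x +
        ((fun z => χ z * v z j) ⋆ FunctionSpaces.Torus.partialDeriv i (FunctionSpaces.Torus.partialDeriv i K)) x := by
  have hvj : Integrable (fun z => v z j) volume := hv.eval_piLp j
  have hχvj : Integrable (fun z => χ z * v z j) volume := hχ.integrable_smul hvj
  have hKi : FunctionSpaces.Torus.IsSmooth (FunctionSpaces.Torus.partialDeriv i K) := hK.partialDeriv i
  have h1 : FunctionSpaces.Torus.partialDeriv i (fun y => symmTestField K χ v y j) =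
      (fun x => FunctionSpaces.Torus.partialDeriv i χ x * ((fun z => v z j) ⋆ K) x +
        χ x * ((fun z => v z j) ⋆ FunctionSpaces.Torus.partialDeriv i K) x) +
        ((fun z => χ z * v z j) ⋆ FunctionSpaces.Torus.partialDeriv i K) := by
    funext y
    rw [Pi.add_apply, partialDeriv_symmTestField_kernel hK hχ hv i j y]
  have hW : FunctionSpaces.Torus.IsSmooth ((fun z => v z j) ⋆ K) := FunctionSpaces.Torus.isSmooth_convolution hvj hK
  have hWd : FunctionSpaces.Torus.IsSmooth ((fun z => v z j) ⋆ FunctionSpaces.Torus.partialDeriv i K) :=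
    FunctionSpaces.Torus.isSmooth_convolution hvj hKi
  have hVd : FunctionSpaces.Torus.IsSmooth ((fun z => χ z * v z j) ⋆ FunctionSpaces.Torus.partialDeriv i K) :=
    FunctionSpaces.Torus.isSmooth_convolution hχvj hKi
  have hχi : FunctionSpaces.Torus.IsSmooth (FunctionSpaces.Torus.partialDeriv i χ) := hχ.partialDeriv i
  have hA : FunctionSpaces.Torus.IsContDiff 1 (fun x => FunctionSpaces.Torus.partialDeriv i χ x * ((fun z => v z j) ⋆ K) x) :=
    (hχi.smul' hW).isContDiff (by simp)
  have hB : FunctionSpaces.Torus.IsContDiff 1 (fun x => χ x * ((fun z => v z j) ⋆ FunctionSpaces.Torus.partialDeriv i K) x) :=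
    (hχ.smul' hWd).isContDiff (by simp)
  have hAB : FunctionSpaces.Torus.IsContDiff 1 (fun x => FunctionSpaces.Torus.partialDeriv i χ x * ((fun z => v z j) ⋆ K) x +
        χ x * ((fun z => v z j) ⋆ FunctionSpaces.Torus.partialDeriv i K) x) := hA.add hB
  have hAB' : (fun x => FunctionSpaces.Torus.partialDeriv i χ x * ((fun z => v z j) ⋆ K) x +
        χ x * ((fun z => v z j) ⋆ FunctionSpaces.Torus.partialDeriv i K) x) =
      (fun x => FunctionSpaces.Torus.partialDeriv i χ x * ((fun z => v z j) ⋆ K) x) +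
        fun x => χ x * ((fun z => v z j) ⋆ FunctionSpaces.Torus.partialDeriv i K) x := by
    funext y; rfl
  rw [h1, FunctionSpaces.Torus.partialDeriv_add hAB (hVd.isContDiff (by simp)), Pi.add_apply, hAB',
    FunctionSpaces.Torus.partialDeriv_add hA hB, Pi.add_apply,
    FunctionSpaces.Torus.partialDeriv_mul (hχi.isContDiff (by simp)) (hW.isContDiff (by simp)),
    FunctionSpaces.Torus.partialDeriv_mul (hχ.isContDiff (by simp)) (hWd.isContDiff (by simp)),
    FunctionSpaces.Torus.partialDeriv_convolution hvj hK, FunctionSpaces.Torus.partialDeriv_convolution hvj hKi,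
    FunctionSpaces.Torus.partialDeriv_convolution hχvj hKi]
  ring

/-- **Laplacian of the components of the symmetric field**:
`ΔΦⱼ = Δχ (vⱼ ⋆ K) + 2 ∑ᵢ ∂ᵢχ (vⱼ ⋆ ∂ᵢK) + χ ∑ᵢ (vⱼ ⋆ ∂ᵢ∂ᵢK) + ∑ᵢ (χvⱼ) ⋆ ∂ᵢ∂ᵢK`. [folklore] -/
theorem laplacian_symmTestField_apply (hK : FunctionSpaces.Torus.IsSmooth K)
    (hχ : FunctionSpaces.Torus.IsSmooth χ) (hv : Integrable v volume) (j : d) (x : UnitAddTorus d) :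
    FunctionSpaces.Torus.laplacian (fun y => symmTestField K χ v y j) x =
      FunctionSpaces.Torus.laplacian χ x * ((fun z => v z j) ⋆ K) x +
        2 * ∑ i, FunctionSpaces.Torus.partialDeriv i χ x * ((fun z => v z j) ⋆ FunctionSpaces.Torus.partialDeriv i K) x +
        χ x * ∑ i, ((fun z => v z j) ⋆ FunctionSpaces.Torus.partialDeriv i (FunctionSpaces.Torus.partialDeriv i K)) x +
        ∑ i, ((fun z => χ z * v z j) ⋆ FunctionSpaces.Torus.partialDeriv i (FunctionSpaces.Torus.partialDeriv i K)) x := by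
  have hs : FunctionSpaces.Torus.IsSmooth (fun y => symmTestField K χ v y j) :=
    (EuclideanSpace.proj (𝕜 := ℝ) j).contDiff.comp (isSmooth_symmTestField hK hχ hv)
  rw [FunctionSpaces.Torus.laplacian_eq_sum_partialDeriv_partialDeriv hs,
    FunctionSpaces.Torus.laplacian_eq_sum_partialDeriv_partialDeriv hχ]
  simp_rw [partialDeriv_partialDeriv_symmTestField hK hχ hv]
  rw [Finset.sum_add_distrib, Finset.sum_add_distrib, Finset.sum_add_distrib, Finset.sum_mul, Finset.mul_sum,
    Finset.mul_sum]

/-- The Laplacian pairing of the symmetric field, componentwise: `⟪w, ΔΦ⟫ = ∑ⱼ wⱼ ΔΦⱼ`. [folklore] -/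
theorem inner_laplacian_symmTestField_eq_sum (hK : FunctionSpaces.Torus.IsSmooth K)
    (hχ : FunctionSpaces.Torus.IsSmooth χ) (hv : Integrable v volume) (w : EuclideanSpace ℝ d) (x : UnitAddTorus d) :
    ⟪w, FunctionSpaces.Torus.laplacian (symmTestField K χ v) x⟫ =
      ∑ j, w j * FunctionSpaces.Torus.laplacian (fun y => symmTestField K χ v y j) x := by
  rw [PiLp.inner_apply]
  refine Finset.sum_congr rfl fun j _ => ?_
  rw [laplacian_apply_eq (isSmooth_symmTestField hK hχ hv) x j]
  simp [mul_comm]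

/-- The divergence of the symmetric field through `vᵢ ⋆ ∂ᵢK` (no divergence-freeness used):
`div Φ = ∑ᵢ [∂ᵢχ (vᵢ ⋆ K) + χ (vᵢ ⋆ ∂ᵢK) + (χvᵢ) ⋆ ∂ᵢK]`. [folklore] -/
theorem divergence_symmTestField_eq_sum (hK : FunctionSpaces.Torus.IsSmooth K)
    (hχ : FunctionSpaces.Torus.IsSmooth χ) (hv : Integrable v volume) (x : UnitAddTorus d) :
    FunctionSpaces.Torus.divergence (symmTestField K χ v) x =
      ∑ i, (FunctionSpaces.Torus.partialDeriv i χ x * ((fun z => v z i) ⋆ K) x +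
        χ x * ((fun z => v z i) ⋆ FunctionSpaces.Torus.partialDeriv i K) x +
        ((fun z => χ z * v z i) ⋆ FunctionSpaces.Torus.partialDeriv i K) x) := by
  unfold FunctionSpaces.Torus.divergence
  exact Finset.sum_congr rfl fun i _ => partialDeriv_symmTestField_kernel hK hχ hv i i x

end SliceFormulas

/-! ## Finite sums of `Lᵖ`-convergent sequences -/

section SumLimit

variable {α : Type*} [MeasurableSpace α] {μ : Measure α} {ι κ : Type*} {l : Filter ι}

/-- `Lᵖ` convergence is stable under finite sums (`1 ≤ p`). [folklore] -/
theorem tendsto_eLpNorm_finset_sum_sub (s : Finset κ) {f : ι → κ → α → ℝ} {f₀ : κ → α → ℝ} {p : ℝ≥0∞}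
    (hp : 1 ≤ p) (hm : ∀ k ∈ s, ∀ᶠ i in l, AEStronglyMeasurable (fun x => f i k x - f₀ k x) μ)
    (h : ∀ k ∈ s, Tendsto (fun i => eLpNorm (fun x => f i k x - f₀ k x) p μ) l (𝓝 0)) :
    Tendsto (fun i => eLpNorm (fun x => ∑ k ∈ s, f i k x - ∑ k ∈ s, f₀ k x) p μ) l (𝓝 0) := by
  have hsum : Tendsto (fun i => ∑ k ∈ s, eLpNorm (fun x => f i k x - f₀ k x) p μ) l (𝓝 0) := by
    have := tendsto_finsetSum s fun k hk => h k hk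
    rwa [Finset.sum_const_zero] at this
  refine tendsto_of_tendsto_of_tendsto_of_le_of_le' tendsto_const_nhds hsum
    (Eventually.of_forall fun i => bot_le) ?_
  have hall : ∀ᶠ i in l, ∀ k ∈ s, AEStronglyMeasurable (fun x => f i k x - f₀ k x) μ :=
    (s.eventually_all).2 hm
  filter_upwards [hall] with i hi
  have e : (fun x => ∑ k ∈ s, f i k x - ∑ k ∈ s, f₀ k x) = ∑ k ∈ s, fun x => f i k x - f₀ k x := by
    funext x
    simp only [Finset.sum_apply, Finset.sum_sub_distrib]
  rw [e]
  exact eLpNorm_sum_le hi hp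

end SumLimit

/-! ## Zero fields: their torus derivatives vanish -/

section ZeroField

variable [DecidableEq d]

omit [Fintype d] in
/-- Partial derivatives of the zero function vanish. [folklore] -/
theorem partialDeriv_zero_fun {F' : Type*} [NormedAddCommGroup F'] [NormedSpace ℝ F'] (i : d) (x : UnitAddTorus d) :
    FunctionSpaces.Torus.partialDeriv i (fun _ : UnitAddTorus d => (0 : F')) x = 0 := by
  simp [FunctionSpaces.Torus.partialDeriv, FunctionSpaces.Torus.lineDeriv]

/-- The Laplacian of the zero function vanishes. [folklore] -/
theorem laplacian_zero_fun {F' : Type*} [NormedAddCommGroup F'] [NormedSpace ℝ F'] (x : UnitAddTorus d) :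
    FunctionSpaces.Torus.laplacian (fun _ : UnitAddTorus d => (0 : F')) x = 0 := by
  rw [FunctionSpaces.Torus.laplacian_eq_sum_partialDeriv_partialDeriv (FunctionSpaces.Torus.isSmooth_const (0 : F'))]
  refine Finset.sum_eq_zero fun i _ => ?_
  have h : FunctionSpaces.Torus.partialDeriv i (fun _ : UnitAddTorus d => (0 : F')) = fun _ => 0 :=
    funext fun y => partialDeriv_zero_fun i y
  rw [h, partialDeriv_zero_fun]

end ZeroField

/-! ## The discharge of `symmTestField_identity` -/

section Discharge

variable [DecidableEq d]

/-- **Discharge of `Torus.IsDistributionalNSSolutionOn.symmTestField_identity`** (Duchon–Robert 2000,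
proof of Prop. 1, p. 250: "(NS)·u^ε + (NS^ε)·u", the tested momentum equation for the symmetric
field `Φ = ψ u^K + (ψu) ⋆ K`; its justification for weak solutions is the time-mollification
argument of CCFS 2008, §3.1, here with the test fields
`Φₙ = ψ · (ū ⋆_{t,x} (ρₙ ⊗ K)) + (ψ ū) ⋆_{t,x} (ρₙ ⊗ K)` — smooth, compactly supported in `(0,T)` —
whose time-derivative pairing is *exactly* `∫∫ ∂ₜψ ⟪ū, ū ⋆ (ρₙ ⊗ K)⟫`
(`integral_mul_timeDeriv_drTest`), and whose space derivatives converge in `L³(ℝ × T^d)` to those of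
`Φ` (space–time mollification → slice-wise mollification, `tendsto_eLpNorm_stConv_sub_sliceConv`)
against the fixed factors `ūⱼ`, `ūⱼūᵢ`, `p̄ ∈ L^{3/2}`). [cite: DuchonRobert2000, proof of Prop. 1 p. 250] -/
theorem symmTestField_identity_holds : IsDistributionalNSSolutionOn.symmTestField_identity (d := d) := by
  intro T ν u p hsol hu3 hp K hK hKev ψ hψ
  -- degenerate time interval
  rcases le_or_gt T 0 with hT | hT
  · simp [Ioo_eq_empty_of_le hT, Measure.restrict_empty]
  set μ : Measure (ℝ × UnitAddTorus d) := (volume : Measure ℝ).prod volume with hμ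
  have hKc : Continuous K := hK.continuous
  have hK1 : FunctionSpaces.Torus.IsContDiff 1 K := hK.isContDiff (by simp)
  ------------------------------------------------------------------ ψ data
  obtain ⟨⟨hψst, b, hbT, hψb0⟩, a, ha, hψa0⟩ := hψ
  have hψab : ∀ t, (t ≤ a ∨ b ≤ t) → ψ t = 0 := fun t ht => by
    rcases ht with ht | ht
    · exact hψa0 t ht
    · exact hψb0 t ht
  have hψ' : FunctionSpaces.Torus.IsSpaceTimeTestIoo T ψ := ⟨⟨hψst, b, hbT, hψb0⟩, a, ha, hψa0⟩
  obtain ⟨hψsm, hdtsm, -, -⟩ := hψ'.isSpaceTimeTest.isSmoothSpaceTimeOn_derived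
  have hψdi : ∀ i, FunctionSpaces.Torus.IsSmoothSpaceTimeOn univ (fun t => FunctionSpaces.Torus.partialDeriv i (ψ t)) :=
    fun i => hψsm.partialDeriv uniqueDiffOn_univ i
  have hψL : FunctionSpaces.Torus.IsSmoothSpaceTimeOn univ (fun t => FunctionSpaces.Torus.laplacian (ψ t)) :=
    hψsm.laplacian uniqueDiffOn_univ
  -- vanishing off `[a - 1, b + 1]`
  have hψ0 : ∀ t, t ∉ Icc (a - 1) (b + 1) → ψ t = 0 := fun t ht => by
    refine hψab t ?_
    rcases lt_or_ge t (a - 1) with h | h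
    · left; linarith
    · right
      by_contra h'
      exact ht ⟨h, by linarith [not_le.1 h']⟩
  have hψ0' : ∀ t, t ∉ Icc (a - 1) (b + 1) → ∀ᶠ τ in 𝓝 t, ψ τ = 0 := fun t ht => by
    rcases lt_or_ge t (a - 1) with h | h
    · filter_upwards [Iio_mem_nhds (show t < a by linarith)] with τ hτ
      exact hψab τ (Or.inl (le_of_lt hτ))
    · have hb' : b + 1 < t := by
        by_contra h'
        exact ht ⟨h, not_lt.1 h'⟩
      filter_upwards [Ioi_mem_nhds (show b < t by linarith)] with τ hτ
      exact hψab τ (Or.inr (le_of_lt hτ))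
  have hdt0 : ∀ t, t ∉ Icc (a - 1) (b + 1) → FunctionSpaces.Torus.timeDeriv ψ t = 0 := fun t ht => by
    funext x
    have hev : (fun τ => ψ τ x) =ᶠ[𝓝 t] fun _ => (0 : ℝ) := by
      filter_upwards [hψ0' t ht] with τ hτ
      rw [hτ, Pi.zero_apply]
    show deriv (fun τ => ψ τ x) t = 0
    rw [hev.deriv_eq, deriv_const]
  have hdi0 : ∀ i t, t ∉ Icc (a - 1) (b + 1) → (fun t => FunctionSpaces.Torus.partialDeriv i (ψ t)) t = 0 := fun i t ht => by
    funext x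
    show FunctionSpaces.Torus.partialDeriv i (ψ t) x = 0
    rw [hψ0 t ht]
    exact partialDeriv_zero_fun i x
  have hL0 : ∀ t, t ∉ Icc (a - 1) (b + 1) → (fun t => FunctionSpaces.Torus.laplacian (ψ t)) t = 0 := fun t ht => by
    funext x
    show FunctionSpaces.Torus.laplacian (ψ t) x = 0
    rw [hψ0 t ht]
    exact laplacian_zero_fun x
  -- global bounds and continuity
  obtain ⟨Cψ, -, hCψ⟩ := exists_forall_norm_le_of_isSmoothSpaceTimeOn hψsm hψ0
  obtain ⟨Cψt, -, hCψt⟩ := exists_forall_norm_le_of_isSmoothSpaceTimeOn hdtsm hdt0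
  choose Cψi hCψi0 hCψi using fun i => exists_forall_norm_le_of_isSmoothSpaceTimeOn (hψdi i) (hdi0 i)
  obtain ⟨CψL, -, hCψL⟩ := exists_forall_norm_le_of_isSmoothSpaceTimeOn hψL hL0
  have hψb : ∀ t x, |ψ t x| ≤ Cψ := fun t x => by rw [← Real.norm_eq_abs]; exact hCψ t x
  have hψtb : ∀ t x, |FunctionSpaces.Torus.timeDeriv ψ t x| ≤ Cψt := fun t x => by rw [← Real.norm_eq_abs]; exact hCψt t x
  have hψib : ∀ i t x, |FunctionSpaces.Torus.partialDeriv i (ψ t) x| ≤ Cψi i := fun i t x => by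
    rw [← Real.norm_eq_abs]; exact hCψi i t x
  have hψLb : ∀ t x, |FunctionSpaces.Torus.laplacian (ψ t) x| ≤ CψL := fun t x => by rw [← Real.norm_eq_abs]; exact hCψL t x
  have hψc : Continuous (uncurry ψ) := hψsm.continuous_uncurry
  have hψtc : Continuous (uncurry (FunctionSpaces.Torus.timeDeriv ψ)) := hdtsm.continuous_uncurry
  have hψic : ∀ i, Continuous (uncurry fun t x => FunctionSpaces.Torus.partialDeriv i (ψ t) x) := fun i =>
    (hψdi i).continuous_uncurry
  have hψLc : Continuous (uncurry fun t x => FunctionSpaces.Torus.laplacian (ψ t) x) := hψL.continuous_uncurry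
  have hψslice : ∀ t, FunctionSpaces.Torus.IsSmooth (ψ t) := fun t => isSmooth_slice_of_contDiff_stLift hψst t
  ------------------------------------------------------------------ time bumps
  set δ₀ : ℝ := min a (T - b) / 2 with hδ₀
  have hmin : 0 < min a (T - b) := lt_min ha (by linarith)
  have hδ₀pos : 0 < δ₀ := by positivity
  have hδ₀a : 0 < a - δ₀ := by
    have := min_le_left a (T - b); rw [hδ₀]; linarith
  have hδ₀b : b + δ₀ < T := by
    have := min_le_right a (T - b); rw [hδ₀]; linarith
  obtain ⟨φ, hφlt, hφ0⟩ := exists_contDiffBump_seq_lt hδ₀pos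
  set ρ : ℕ → ℝ → ℝ := fun n => (φ n).normed volume with hρdef
  have hρs : ∀ n, ContDiff ℝ ∞ (ρ n) := fun n => (φ n).contDiff_normed
  have hρc : ∀ n, HasCompactSupport (ρ n) := fun n => (φ n).hasCompactSupport_normed
  have hρcont : ∀ n, Continuous (ρ n) := fun n => (φ n).continuous_normed
  have hρeven : ∀ n r, ρ n (-r) = ρ n r := fun n r => (φ n).normed_neg r
  have hρsupp : ∀ n r, ρ n r ≠ 0 → |r| < δ₀ := fun n r h =>
    (abs_lt_of_normed_ne_zero (φ n) h).trans (hφlt n)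
  ------------------------------------------------------------------ velocity and pressure data
  have hm : AEStronglyMeasurable (uncurry u) ((volume.restrict (Ioo 0 T)).prod volume) :=
    aestronglyMeasurable_uncurry_prod hsol.1
  have hbar1 : Integrable (stBar T u) μ := integrable_stBar hm hsol.2.1
  have hbar2 : MemLp (stBar T u) 2 μ := by
    have := memLp_stBar hm two_ne_zero hsol.2.1
    simpa using this
  have hbar3 : MemLp (stBar T u) 3 μ := by
    have := memLp_stBar hm (by norm_num : (3 : ℕ) ≠ 0) hu3
    simpa using this
  have hbar32 : MemLp (stBar T u) (3 / 2) μ := by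
    have h : MemLp (uncurry u) 3 ((volume.restrict (Ioo 0 T)).prod volume) := by
      have h3 := hbar3
      rw [stBar, memLp_indicator_iff_restrict (measurableSet_Ioo.prod MeasurableSet.univ),
        ← Measure.restrict_prod_eq_prod_univ] at h3
      exact h3
    have h' : MemLp (uncurry u) (3 / 2) ((volume.restrict (Ioo 0 T)).prod volume) :=
      h.mono_exponent (ENNReal.div_le_of_le_mul (by norm_num))
    rw [stBar, memLp_indicator_iff_restrict (measurableSet_Ioo.prod MeasurableSet.univ),
      ← Measure.restrict_prod_eq_prod_univ]
    exact h'
  have hsmeas : ∀ j, AEStronglyMeasurable (fun q => stBar T u q j) μ := fun j => (hbar2.eval_piLp j).1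
  set Uc : d → ℝ × UnitAddTorus d → ℝ := fun j => (hsmeas j).mk _ with hUcdef
  have hUm : ∀ j, StronglyMeasurable (Uc j) := fun j => (hsmeas j).stronglyMeasurable_mk
  have hUc : ∀ j, Uc j =ᵐ[μ] fun q => stBar T u q j := fun j => (hsmeas j).ae_eq_mk.symm
  have hU1 : ∀ j, Integrable (Uc j) μ := fun j =>
    ((EuclideanSpace.proj (𝕜 := ℝ) j).integrable_comp hbar1).congr (hsmeas j).ae_eq_mk
  have hU3 : ∀ j, MemLp (Uc j) 3 μ := fun j => (hbar3.eval_piLp j).ae_eq (hsmeas j).ae_eq_mk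
  have hU32' : ∀ j, MemLp (Uc j) (3 / 2) μ := fun j => (hbar32.eval_piLp j).ae_eq (hsmeas j).ae_eq_mk
  have hU32 : ∀ j i, MemLp (fun q => Uc j q * Uc i q) (3 / 2) μ := fun j i => by
    haveI := FunctionSpaces.holderTriple_three_three
    exact (hU3 i).mul (hU3 j)
  have hpbar1 : Integrable (stBarScalar T p) μ := integrable_stBarScalar hsol.2.2.1 hsol.2.2.2.1
  have hpbar32 : MemLp (stBarScalar T p) (3 / 2) μ := memLp_stBarScalar hsol.2.2.1 hp
  -- the cut-off components `Ψⱼ = ψ Uⱼ`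
  set Ψ : d → ℝ × UnitAddTorus d → ℝ := fun j q => ψ q.1 q.2 * Uc j q with hΨdef
  have hΨm : ∀ j, StronglyMeasurable (Ψ j) := fun j =>
    (hψc.stronglyMeasurable.comp_measurable (measurable_fst.prodMk measurable_snd)).mul (hUm j)
  have hΨ1 : ∀ j, Integrable (Ψ j) μ := fun j => integrable_cutoff_mul (hU1 j) hψc hψb
  have hΨ3 : ∀ j, MemLp (Ψ j) 3 μ := fun j => by
    refine ⟨(hΨm j).aestronglyMeasurable, lt_of_le_of_lt (eLpNorm_le_mul_eLpNorm_of_ae_le_mul (g := Uc j) (c := Cψ)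
      (Eventually.of_forall fun q => ?_) 3) (ENNReal.mul_lt_top ENNReal.ofReal_lt_top (hU3 j).2)⟩
    simp only [hΨdef, norm_mul, Real.norm_eq_abs]
    exact mul_le_mul_of_nonneg_right (hψb _ _) (abs_nonneg _)
  ------------------------------------------------------------------ the test fields
  set φc : ℕ → d → ℝ → UnitAddTorus d → ℝ := fun n j => drTest (ρ n) K ψ (Uc j) with hφcdef
  have hφs : ∀ n j, ContDiff ℝ ∞ (FunctionSpaces.Torus.stLift (φc n j)) := fun n j =>
    contDiff_stLift_drTest (hU1 j) (hρs n) (hρc n) hK hψst hψb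
  have hφzero : ∀ n t, (t ≤ a - δ₀ ∨ b + δ₀ ≤ t) → vecField (φc n) t = 0 := by
    intro n t ht
    funext x
    ext j
    simp only [vecField_apply, hφcdef]
    rw [drTest_eq_zero_of_dist hδ₀pos hψab (hρsupp n) ht x]
    rfl
  have htest : ∀ n, FunctionSpaces.Torus.IsSpaceTimeTestIoo T (vecField (φc n)) := fun n =>
    ⟨⟨by rw [stLift_vecField]; exact contDiff_piLp' (p := 2) fun j => hφs n j,
      b + δ₀, hδ₀b, fun t ht => hφzero n t (Or.inr ht)⟩,
      a - δ₀, hδ₀a, fun t ht => hφzero n t (Or.inl ht)⟩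
  have hweak : ∀ n, ∫ t in Ioo 0 T, ∫ x, (⟪u t x, FunctionSpaces.Torus.timeDeriv (vecField (φc n)) t x⟫ +
      ⟪u t x, FunctionSpaces.Torus.convect (u t) (vecField (φc n) t) x⟫ +
        ν * ⟪u t x, FunctionSpaces.Torus.laplacian (vecField (φc n) t) x⟫ +
        p t x * FunctionSpaces.Torus.divergence (vecField (φc n) t) x +
        ⟪(0 : ℝ → UnitAddTorus d → EuclideanSpace ℝ d) t x, vecField (φc n) t x⟫) = 0 := fun n =>
    hsol.2.2.2.2.2 _ (htest n)
  ------------------------------------------------------------------ generic facts on the mollified pieces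
  have hSc : ∀ n {F : ℝ × UnitAddTorus d → ℝ} (_ : Integrable F μ) {k : UnitAddTorus d → ℝ}
      (_ : FunctionSpaces.Torus.IsSmooth k), Continuous (uncurry (FunctionSpaces.Torus.stConv (ρ n) k F)) :=
    fun n F hF k hk => FunctionSpaces.Torus.continuous_uncurry_of_continuous_stLift
      (FunctionSpaces.Torus.contDiff_top_stLift_stConv hF (hρs n) (hρc n) hk).continuous
  have hS'c : ∀ n {F : ℝ × UnitAddTorus d → ℝ} (_ : Integrable F μ) {k : UnitAddTorus d → ℝ}
      (_ : FunctionSpaces.Torus.IsSmooth k), Continuous (uncurry (FunctionSpaces.Torus.stConv (deriv (ρ n)) k F)) :=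
    fun n F hF k hk => FunctionSpaces.Torus.continuous_uncurry_of_continuous_stLift
      (FunctionSpaces.Torus.contDiff_top_stLift_stConv hF (hρs n).deriv' (hρc n).deriv hk).continuous
  have hSb : ∀ n {F : ℝ × UnitAddTorus d → ℝ} (_ : Integrable F μ) {k : UnitAddTorus d → ℝ} (_ : Continuous k),
      ∃ C, ∀ t x, |FunctionSpaces.Torus.stConv (ρ n) k F t x| ≤ C :=
    fun n F hF k hk => exists_abs_stConv_le hF (hρcont n) (hρc n) hk
  have hS'b : ∀ n {F : ℝ × UnitAddTorus d → ℝ} (_ : Integrable F μ) {k : UnitAddTorus d → ℝ} (_ : Continuous k),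
      ∃ C, ∀ t x, |FunctionSpaces.Torus.stConv (deriv (ρ n)) k F t x| ≤ C :=
    fun n F hF k hk => exists_abs_stConv_le hF ((hρs n).continuous_deriv (by simp)) (hρc n).deriv hk
  have hKi : ∀ i, FunctionSpaces.Torus.IsSmooth (FunctionSpaces.Torus.partialDeriv i K) := fun i => hK.partialDeriv i
  have hKii : ∀ i, FunctionSpaces.Torus.IsSmooth (FunctionSpaces.Torus.partialDeriv i (FunctionSpaces.Torus.partialDeriv i K)) :=
    fun i => (hKi i).partialDeriv i
  ------------------------------------------------------------------ derivative data of the test fields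
  have hdt : ∀ n j t x, FunctionSpaces.Torus.timeDeriv (φc n j) t x =
      FunctionSpaces.Torus.timeDeriv ψ t x * FunctionSpaces.Torus.stConv (ρ n) K (Uc j) t x +
        ψ t x * FunctionSpaces.Torus.stConv (deriv (ρ n)) K (Uc j) t x +
        FunctionSpaces.Torus.stConv (deriv (ρ n)) K (Ψ j) t x := fun n j t x =>
    timeDeriv_drTest (hU1 j) (hρs n) (hρc n) hK hψst hψb t x
  have hdx : ∀ n j i t x, FunctionSpaces.Torus.partialDeriv i (φc n j t) x =
      FunctionSpaces.Torus.partialDeriv i (ψ t) x * FunctionSpaces.Torus.stConv (ρ n) K (Uc j) t x +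
        ψ t x * FunctionSpaces.Torus.stConv (ρ n) (FunctionSpaces.Torus.partialDeriv i K) (Uc j) t x +
        FunctionSpaces.Torus.stConv (ρ n) (FunctionSpaces.Torus.partialDeriv i K) (Ψ j) t x := fun n j i t x =>
    partialDeriv_drTest (hU1 j) (hρs n) (hρc n) hK hψst hψb i t x
  have hdL : ∀ n j t x, FunctionSpaces.Torus.laplacian (φc n j t) x =
      FunctionSpaces.Torus.laplacian (ψ t) x * FunctionSpaces.Torus.stConv (ρ n) K (Uc j) t x +
        2 * ∑ i, FunctionSpaces.Torus.partialDeriv i (ψ t) x *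
          FunctionSpaces.Torus.stConv (ρ n) (FunctionSpaces.Torus.partialDeriv i K) (Uc j) t x +
        ψ t x * ∑ i, FunctionSpaces.Torus.stConv (ρ n)
          (FunctionSpaces.Torus.partialDeriv i (FunctionSpaces.Torus.partialDeriv i K)) (Uc j) t x +
        ∑ i, FunctionSpaces.Torus.stConv (ρ n) (FunctionSpaces.Torus.partialDeriv i (FunctionSpaces.Torus.partialDeriv i K))
          (Ψ j) t x := fun n j t x =>
    laplacian_drTest (hU1 j) (hρs n) (hρc n) hK hψst hψb t x
  have hdtc : ∀ n j, Continuous (uncurry (FunctionSpaces.Torus.timeDeriv (φc n j))) := fun n j => by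
    have e : uncurry (FunctionSpaces.Torus.timeDeriv (φc n j)) = fun q =>
        FunctionSpaces.Torus.timeDeriv ψ q.1 q.2 * FunctionSpaces.Torus.stConv (ρ n) K (Uc j) q.1 q.2 +
          ψ q.1 q.2 * FunctionSpaces.Torus.stConv (deriv (ρ n)) K (Uc j) q.1 q.2 +
          FunctionSpaces.Torus.stConv (deriv (ρ n)) K (Ψ j) q.1 q.2 := by
      funext q; exact hdt n j q.1 q.2
    rw [e]
    exact ((hψtc.mul (hSc n (hU1 j) hK)).add (hψc.mul (hS'c n (hU1 j) hK))).add (hS'c n (hΨ1 j) hK)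
  have hdxc : ∀ n j i, Continuous (uncurry fun t x => FunctionSpaces.Torus.partialDeriv i (φc n j t) x) := fun n j i => by
    have e : (uncurry fun t x => FunctionSpaces.Torus.partialDeriv i (φc n j t) x) = fun q =>
        FunctionSpaces.Torus.partialDeriv i (ψ q.1) q.2 * FunctionSpaces.Torus.stConv (ρ n) K (Uc j) q.1 q.2 +
          ψ q.1 q.2 * FunctionSpaces.Torus.stConv (ρ n) (FunctionSpaces.Torus.partialDeriv i K) (Uc j) q.1 q.2 +
          FunctionSpaces.Torus.stConv (ρ n) (FunctionSpaces.Torus.partialDeriv i K) (Ψ j) q.1 q.2 := by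
      funext q; exact hdx n j i q.1 q.2
    rw [e]
    exact (((hψic i).mul (hSc n (hU1 j) hK)).add (hψc.mul (hSc n (hU1 j) (hKi i)))).add (hSc n (hΨ1 j) (hKi i))
  have hdLc : ∀ n j, Continuous (uncurry fun t x => FunctionSpaces.Torus.laplacian (φc n j t) x) := fun n j => by
    have e : (uncurry fun t x => FunctionSpaces.Torus.laplacian (φc n j t) x) = fun q =>
        FunctionSpaces.Torus.laplacian (ψ q.1) q.2 * FunctionSpaces.Torus.stConv (ρ n) K (Uc j) q.1 q.2 +
          2 * ∑ i, FunctionSpaces.Torus.partialDeriv i (ψ q.1) q.2 *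
            FunctionSpaces.Torus.stConv (ρ n) (FunctionSpaces.Torus.partialDeriv i K) (Uc j) q.1 q.2 +
          ψ q.1 q.2 * ∑ i, FunctionSpaces.Torus.stConv (ρ n)
            (FunctionSpaces.Torus.partialDeriv i (FunctionSpaces.Torus.partialDeriv i K)) (Uc j) q.1 q.2 +
          ∑ i, FunctionSpaces.Torus.stConv (ρ n) (FunctionSpaces.Torus.partialDeriv i (FunctionSpaces.Torus.partialDeriv i K))
            (Ψ j) q.1 q.2 := by
      funext q; exact hdL n j q.1 q.2
    rw [e]
    refine (((hψLc.mul (hSc n (hU1 j) hK)).add (continuous_const.mul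
      (continuous_finsetSum _ fun i _ => (hψic i).mul (hSc n (hU1 j) (hKi i))))).add
      (hψc.mul (continuous_finsetSum _ fun i _ => hSc n (hU1 j) (hKii i)))).add
      (continuous_finsetSum _ fun i _ => hSc n (hΨ1 j) (hKii i))
  have hdtb : ∀ n j, ∃ C, ∀ t x, |FunctionSpaces.Torus.timeDeriv (φc n j) t x| ≤ C := fun n j => by
    obtain ⟨M₀, hM₀⟩ := hSb n (hU1 j) hKc
    obtain ⟨M₁, hM₁⟩ := hS'b n (hU1 j) hKc
    obtain ⟨M₂, hM₂⟩ := hS'b n (hΨ1 j) hKc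
    refine ⟨Cψt * M₀ + Cψ * M₁ + M₂, fun t x => ?_⟩
    rw [hdt]
    have h1 : |FunctionSpaces.Torus.timeDeriv ψ t x * FunctionSpaces.Torus.stConv (ρ n) K (Uc j) t x| ≤ Cψt * M₀ := by
      rw [abs_mul]; exact mul_le_mul (hψtb _ _) (hM₀ _ _) (abs_nonneg _) ((abs_nonneg _).trans (hψtb 0 0))
    have h2 : |ψ t x * FunctionSpaces.Torus.stConv (deriv (ρ n)) K (Uc j) t x| ≤ Cψ * M₁ := by
      rw [abs_mul]; exact mul_le_mul (hψb _ _) (hM₁ _ _) (abs_nonneg _) ((abs_nonneg _).trans (hψb 0 0))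
    exact ((abs_add_le _ _).trans (add_le_add ((abs_add_le _ _).trans (add_le_add h1 h2)) (hM₂ _ _)))
  have hdxb : ∀ n j i, ∃ C, ∀ t x, |FunctionSpaces.Torus.partialDeriv i (φc n j t) x| ≤ C := fun n j i => by
    obtain ⟨M₀, hM₀⟩ := hSb n (hU1 j) hKc
    obtain ⟨M₁, hM₁⟩ := hSb n (hU1 j) (hKi i).continuous
    obtain ⟨M₂, hM₂⟩ := hSb n (hΨ1 j) (hKi i).continuous
    refine ⟨Cψi i * M₀ + Cψ * M₁ + M₂, fun t x => ?_⟩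
    rw [hdx]
    have h1 : |FunctionSpaces.Torus.partialDeriv i (ψ t) x * FunctionSpaces.Torus.stConv (ρ n) K (Uc j) t x| ≤ Cψi i * M₀ := by
      rw [abs_mul]; exact mul_le_mul (hψib i _ _) (hM₀ _ _) (abs_nonneg _) (hCψi0 i)
    have h2 : |ψ t x * FunctionSpaces.Torus.stConv (ρ n) (FunctionSpaces.Torus.partialDeriv i K) (Uc j) t x| ≤ Cψ * M₁ := by
      rw [abs_mul]; exact mul_le_mul (hψb _ _) (hM₁ _ _) (abs_nonneg _) ((abs_nonneg _).trans (hψb 0 0))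
    exact ((abs_add_le _ _).trans (add_le_add ((abs_add_le _ _).trans (add_le_add h1 h2)) (hM₂ _ _)))
  have hdLb : ∀ n j, ∃ C, ∀ t x, |FunctionSpaces.Torus.laplacian (φc n j t) x| ≤ C := fun n j => by
    -- compact support in time: the field vanishes for `t ∉ [a - δ₀, b + δ₀]`
    have hcs : HasCompactSupport (uncurry fun t x => FunctionSpaces.Torus.laplacian (φc n j t) x) := by
      refine HasCompactSupport.intro' ((isCompact_Icc (a := a - δ₀) (b := b + δ₀)).prod isCompact_univ)
        ((isClosed_Icc.prod isClosed_univ)) fun q hq => ?_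
      have ht : q.1 ≤ a - δ₀ ∨ b + δ₀ ≤ q.1 := by
        by_contra h
        rw [not_or, not_le, not_le] at h
        exact hq ⟨⟨h.1.le, h.2.le⟩, mem_univ _⟩
      have hz : φc n j q.1 = fun _ => 0 := by
        funext x
        have := congrArg (fun f => f x j) (hφzero n q.1 ht)
        simpa [vecField] using this
      show FunctionSpaces.Torus.laplacian (φc n j q.1) q.2 = 0
      rw [hz]
      exact laplacian_zero_fun q.2
    obtain ⟨C, hC⟩ := (hdLc n j).bounded_above_of_compact_support hcs
    exact ⟨C, fun t x => by simpa [Real.norm_eq_abs] using hC (t, x)⟩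
  ------------------------------------------------------------------ (Eₙ)
  have hEn : ∀ n, ∑ j, ∫ q, Uc j q * FunctionSpaces.Torus.timeDeriv (φc n j) q.1 q.2 ∂μ +
      ∑ j, ∑ i, ∫ q, Uc j q * Uc i q * FunctionSpaces.Torus.partialDeriv i (φc n j q.1) q.2 ∂μ +
      ν * ∑ j, ∫ q, Uc j q * FunctionSpaces.Torus.laplacian (φc n j q.1) q.2 ∂μ +
      ∫ q, stBarScalar T p q * ∑ i, FunctionSpaces.Torus.partialDeriv i (φc n i q.1) q.2 ∂μ = 0 := fun n =>
    weakForm_rewrite_pressure (hweak n) (hφs n) (hdtc n) (hdxc n) (hdLc n) (hdtb n) (hdxb n) (hdLb n)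
      hbar1 hbar2 hpbar1 hUc
  ------------------------------------------------------------------ `L³` limits of the mollified pieces
  have h13 : (1 : ℝ≥0∞) ≤ 3 := by norm_num
  have h3t : (3 : ℝ≥0∞) ≠ ⊤ := ENNReal.ofNat_ne_top
  -- generic: `stConv (ρ n) k F → sliceConv F k` in `L³`, with limit in `L³`
  have hconv : ∀ {F : ℝ × UnitAddTorus d → ℝ} (_ : StronglyMeasurable F) (_ : Integrable F μ) (_ : MemLp F 3 μ)
      {k : UnitAddTorus d → ℝ} (_ : Continuous k),
      Tendsto (fun n => eLpNorm (fun q : ℝ × UnitAddTorus d =>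
        FunctionSpaces.Torus.stConv (ρ n) k F q.1 q.2 - sliceConv F k q.1 q.2) 3 μ) atTop (𝓝 0) :=
    fun hFm hF1 hF3 k hk => tendsto_eLpNorm_stConv_sub_sliceConv hφ0 hFm hF1 h13 h3t hF3.2 hk
  have hmem : ∀ {F : ℝ × UnitAddTorus d → ℝ} (_ : StronglyMeasurable F) (_ : MemLp F 3 μ)
      {k : UnitAddTorus d → ℝ} (_ : Continuous k), MemLp (fun q : ℝ × UnitAddTorus d => sliceConv F k q.1 q.2) 3 μ :=
    fun hFm hF3 k hk => ⟨(stronglyMeasurable_uncurry_sliceConv hFm hk).aestronglyMeasurable,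
      (eLpNorm_uncurry_sliceConv_le hFm hk h13 h3t).trans_lt (ENNReal.mul_lt_top hk.integrable_unitAddTorus.2 hF3.2)⟩
  have hmem_mul : ∀ {c : ℝ × UnitAddTorus d → ℝ} {C : ℝ} (_ : Continuous c) (_ : ∀ q, |c q| ≤ C)
      {g : ℝ × UnitAddTorus d → ℝ} (_ : MemLp g 3 μ), MemLp (fun q => c q * g q) 3 μ :=
    fun hcc hcb g hg => hg.of_le_mul (hcc.aestronglyMeasurable.mul hg.1) (Eventually.of_forall fun q => by
      rw [norm_mul, Real.norm_eq_abs]; exact mul_le_mul_of_nonneg_right (hcb q) (norm_nonneg _))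
  have hSm : ∀ n {F : ℝ × UnitAddTorus d → ℝ} (_ : Integrable F μ) {k : UnitAddTorus d → ℝ}
      (_ : FunctionSpaces.Torus.IsSmooth k),
      AEStronglyMeasurable (fun q : ℝ × UnitAddTorus d => FunctionSpaces.Torus.stConv (ρ n) k F q.1 q.2) μ :=
    fun n F hF k hk => (hSc n hF hk).aestronglyMeasurable
  -- the coefficient fields on `ℝ × T^d`
  have hcψ : ∀ q : ℝ × UnitAddTorus d, |ψ q.1 q.2| ≤ Cψ := fun q => hψb q.1 q.2
  have hcψt : ∀ q : ℝ × UnitAddTorus d, |FunctionSpaces.Torus.timeDeriv ψ q.1 q.2| ≤ Cψt := fun q => hψtb q.1 q.2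
  have hcψi : ∀ i (q : ℝ × UnitAddTorus d), |FunctionSpaces.Torus.partialDeriv i (ψ q.1) q.2| ≤ Cψi i := fun i q => hψib i q.1 q.2
  have hcψL : ∀ q : ℝ × UnitAddTorus d, |FunctionSpaces.Torus.laplacian (ψ q.1) q.2| ≤ CψL := fun q => hψLb q.1 q.2
  have hcψc : Continuous fun q : ℝ × UnitAddTorus d => ψ q.1 q.2 := hψc
  have hcψtc : Continuous fun q : ℝ × UnitAddTorus d => FunctionSpaces.Torus.timeDeriv ψ q.1 q.2 := hψtc
  have hcψic : ∀ i, Continuous fun q : ℝ × UnitAddTorus d => FunctionSpaces.Torus.partialDeriv i (ψ q.1) q.2 := hψic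
  have hcψLc : Continuous fun q : ℝ × UnitAddTorus d => FunctionSpaces.Torus.laplacian (ψ q.1) q.2 := hψLc
  ---------------------------------------------------------------- Term 1 (time)
  set g1 : ℕ → d → ℝ × UnitAddTorus d → ℝ := fun n j q =>
    FunctionSpaces.Torus.timeDeriv ψ q.1 q.2 * FunctionSpaces.Torus.stConv (ρ n) K (Uc j) q.1 q.2 with hg1
  set g1i : d → ℝ × UnitAddTorus d → ℝ := fun j q =>
    FunctionSpaces.Torus.timeDeriv ψ q.1 q.2 * sliceConv (Uc j) K q.1 q.2 with hg1i
  have hT1form : ∀ n j, ∫ q, Uc j q * FunctionSpaces.Torus.timeDeriv (φc n j) q.1 q.2 ∂μ = ∫ q, Uc j q * g1 n j q ∂μ :=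
    fun n j => integral_mul_timeDeriv_drTest (hU1 j) (hρs n) (hρc n) (hρeven n) hK hKev hψst hψb hψtc hψtb
  have hT1lim : Tendsto (fun n => ∑ j, ∫ q, Uc j q * FunctionSpaces.Torus.timeDeriv (φc n j) q.1 q.2 ∂μ) atTop
      (𝓝 (∑ j, ∫ q, Uc j q * g1i j q ∂μ)) := by
    simp_rw [hT1form]
    refine tendsto_finsetSum _ fun j _ => ?_
    refine tendsto_integral_mul_of_tendsto_eLpNorm_three (hU32' j) (fun n => hcψtc.aestronglyMeasurable.mul (hSm n (hU1 j) hK))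
      (hmem_mul hcψtc hcψt (hmem (hUm j) (hU3 j) hKc)) ?_
    exact tendsto_eLpNorm_mul_sub_mul hcψt (hconv (hUm j) (hU1 j) (hU3 j) hKc)
  ---------------------------------------------------------------- Term 2 (convective)
  set g2 : ℕ → d → d → ℝ × UnitAddTorus d → ℝ := fun n j i q =>
    FunctionSpaces.Torus.partialDeriv i (ψ q.1) q.2 * FunctionSpaces.Torus.stConv (ρ n) K (Uc j) q.1 q.2 +
      ψ q.1 q.2 * FunctionSpaces.Torus.stConv (ρ n) (FunctionSpaces.Torus.partialDeriv i K) (Uc j) q.1 q.2 +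
      FunctionSpaces.Torus.stConv (ρ n) (FunctionSpaces.Torus.partialDeriv i K) (Ψ j) q.1 q.2 with hg2
  set g2i : d → d → ℝ × UnitAddTorus d → ℝ := fun j i q =>
    FunctionSpaces.Torus.partialDeriv i (ψ q.1) q.2 * sliceConv (Uc j) K q.1 q.2 +
      ψ q.1 q.2 * sliceConv (Uc j) (FunctionSpaces.Torus.partialDeriv i K) q.1 q.2 +
      sliceConv (Ψ j) (FunctionSpaces.Torus.partialDeriv i K) q.1 q.2 with hg2i
  have hg2m : ∀ n j i, AEStronglyMeasurable (g2 n j i) μ := fun n j i =>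
    (((hcψic i).aestronglyMeasurable.mul (hSm n (hU1 j) hK)).add (hcψc.aestronglyMeasurable.mul
      (hSm n (hU1 j) (hKi i)))).add (hSm n (hΨ1 j) (hKi i))
  have hg2im : ∀ j i, MemLp (g2i j i) 3 μ := fun j i =>
    ((hmem_mul (hcψic i) (hcψi i) (hmem (hUm j) (hU3 j) hKc)).add
      (hmem_mul hcψc hcψ (hmem (hUm j) (hU3 j) (hKi i).continuous))).add (hmem (hΨm j) (hΨ3 j) (hKi i).continuous)
  have hg2conv : ∀ j i, Tendsto (fun n => eLpNorm (fun q => g2 n j i q - g2i j i q) 3 μ) atTop (𝓝 0) := by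
    intro j i
    refine tendsto_eLpNorm_add_sub_add h13 (Eventually.of_forall fun n => ?_) (Eventually.of_forall fun n => ?_)
      (tendsto_eLpNorm_add_sub_add h13 (Eventually.of_forall fun n => ?_) (Eventually.of_forall fun n => ?_)
        (tendsto_eLpNorm_mul_sub_mul (hcψi i) (hconv (hUm j) (hU1 j) (hU3 j) hKc))
        (tendsto_eLpNorm_mul_sub_mul hcψ (hconv (hUm j) (hU1 j) (hU3 j) (hKi i).continuous)))
      (hconv (hΨm j) (hΨ1 j) (hΨ3 j) (hKi i).continuous)
    · exact (((hcψic i).aestronglyMeasurable.mul (hSm n (hU1 j) hK)).add (hcψc.aestronglyMeasurable.mul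
        (hSm n (hU1 j) (hKi i)))).sub (((hcψic i).aestronglyMeasurable.mul (hmem (hUm j) (hU3 j) hKc).1).add
        (hcψc.aestronglyMeasurable.mul (hmem (hUm j) (hU3 j) (hKi i).continuous).1))
    · exact (hSm n (hΨ1 j) (hKi i)).sub (hmem (hΨm j) (hΨ3 j) (hKi i).continuous).1
    · exact ((hcψic i).aestronglyMeasurable.mul (hSm n (hU1 j) hK)).sub
        ((hcψic i).aestronglyMeasurable.mul (hmem (hUm j) (hU3 j) hKc).1)
    · exact (hcψc.aestronglyMeasurable.mul (hSm n (hU1 j) (hKi i))).sub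
        (hcψc.aestronglyMeasurable.mul (hmem (hUm j) (hU3 j) (hKi i).continuous).1)
  have hT2form : ∀ n j i, (fun q => FunctionSpaces.Torus.partialDeriv i (φc n j q.1) q.2) = g2 n j i := fun n j i => by
    funext q; exact hdx n j i q.1 q.2
  have hT2lim : Tendsto (fun n => ∑ j, ∑ i, ∫ q, Uc j q * Uc i q * FunctionSpaces.Torus.partialDeriv i (φc n j q.1) q.2 ∂μ)
      atTop (𝓝 (∑ j, ∑ i, ∫ q, Uc j q * Uc i q * g2i j i q ∂μ)) := by
    refine tendsto_finsetSum _ fun j _ => tendsto_finsetSum _ fun i _ => ?_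
    have e : ∀ n, (fun q => Uc j q * Uc i q * FunctionSpaces.Torus.partialDeriv i (φc n j q.1) q.2) =
        fun q => Uc j q * Uc i q * g2 n j i q := fun n => by
      funext q; rw [hdx n j i q.1 q.2]
    simp_rw [e]
    exact tendsto_integral_mul_of_tendsto_eLpNorm_three (f := fun q => Uc j q * Uc i q) (hU32 j i) (hg2m · j i)
      (hg2im j i) (hg2conv j i)
  ---------------------------------------------------------------- Term 3 (viscous)
  set g3 : ℕ → d → ℝ × UnitAddTorus d → ℝ := fun n j q =>
    FunctionSpaces.Torus.laplacian (ψ q.1) q.2 * FunctionSpaces.Torus.stConv (ρ n) K (Uc j) q.1 q.2 +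
      2 * ∑ i, FunctionSpaces.Torus.partialDeriv i (ψ q.1) q.2 *
        FunctionSpaces.Torus.stConv (ρ n) (FunctionSpaces.Torus.partialDeriv i K) (Uc j) q.1 q.2 +
      ψ q.1 q.2 * ∑ i, FunctionSpaces.Torus.stConv (ρ n)
        (FunctionSpaces.Torus.partialDeriv i (FunctionSpaces.Torus.partialDeriv i K)) (Uc j) q.1 q.2 +
      ∑ i, FunctionSpaces.Torus.stConv (ρ n) (FunctionSpaces.Torus.partialDeriv i (FunctionSpaces.Torus.partialDeriv i K))
        (Ψ j) q.1 q.2 with hg3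
  set g3i : d → ℝ × UnitAddTorus d → ℝ := fun j q =>
    FunctionSpaces.Torus.laplacian (ψ q.1) q.2 * sliceConv (Uc j) K q.1 q.2 +
      2 * ∑ i, FunctionSpaces.Torus.partialDeriv i (ψ q.1) q.2 * sliceConv (Uc j) (FunctionSpaces.Torus.partialDeriv i K) q.1 q.2 +
      ψ q.1 q.2 * ∑ i, sliceConv (Uc j) (FunctionSpaces.Torus.partialDeriv i (FunctionSpaces.Torus.partialDeriv i K)) q.1 q.2 +
      ∑ i, sliceConv (Ψ j) (FunctionSpaces.Torus.partialDeriv i (FunctionSpaces.Torus.partialDeriv i K)) q.1 q.2 with hg3i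
  -- measurability of the pieces
  have m3a : ∀ n j, AEStronglyMeasurable (fun q : ℝ × UnitAddTorus d =>
      FunctionSpaces.Torus.laplacian (ψ q.1) q.2 * FunctionSpaces.Torus.stConv (ρ n) K (Uc j) q.1 q.2) μ :=
    fun n j => hcψLc.aestronglyMeasurable.mul (hSm n (hU1 j) hK)
  have m3ai : ∀ j, AEStronglyMeasurable (fun q : ℝ × UnitAddTorus d =>
      FunctionSpaces.Torus.laplacian (ψ q.1) q.2 * sliceConv (Uc j) K q.1 q.2) μ :=
    fun j => hcψLc.aestronglyMeasurable.mul (hmem (hUm j) (hU3 j) hKc).1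
  have m3b1 : ∀ n j i, AEStronglyMeasurable (fun q : ℝ × UnitAddTorus d => FunctionSpaces.Torus.partialDeriv i (ψ q.1) q.2 *
      FunctionSpaces.Torus.stConv (ρ n) (FunctionSpaces.Torus.partialDeriv i K) (Uc j) q.1 q.2) μ :=
    fun n j i => (hcψic i).aestronglyMeasurable.mul (hSm n (hU1 j) (hKi i))
  have m3b1i : ∀ j i, AEStronglyMeasurable (fun q : ℝ × UnitAddTorus d => FunctionSpaces.Torus.partialDeriv i (ψ q.1) q.2 *
      sliceConv (Uc j) (FunctionSpaces.Torus.partialDeriv i K) q.1 q.2) μ :=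
    fun j i => (hcψic i).aestronglyMeasurable.mul (hmem (hUm j) (hU3 j) (hKi i).continuous).1
  have m3c1 : ∀ n j i, AEStronglyMeasurable (fun q : ℝ × UnitAddTorus d => FunctionSpaces.Torus.stConv (ρ n)
      (FunctionSpaces.Torus.partialDeriv i (FunctionSpaces.Torus.partialDeriv i K)) (Uc j) q.1 q.2) μ :=
    fun n j i => hSm n (hU1 j) (hKii i)
  have m3c1i : ∀ j i, AEStronglyMeasurable (fun q : ℝ × UnitAddTorus d =>
      sliceConv (Uc j) (FunctionSpaces.Torus.partialDeriv i (FunctionSpaces.Torus.partialDeriv i K)) q.1 q.2) μ :=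
    fun j i => (hmem (hUm j) (hU3 j) (hKii i).continuous).1
  have m3d1 : ∀ n j i, AEStronglyMeasurable (fun q : ℝ × UnitAddTorus d => FunctionSpaces.Torus.stConv (ρ n)
      (FunctionSpaces.Torus.partialDeriv i (FunctionSpaces.Torus.partialDeriv i K)) (Ψ j) q.1 q.2) μ :=
    fun n j i => hSm n (hΨ1 j) (hKii i)
  have m3d1i : ∀ j i, AEStronglyMeasurable (fun q : ℝ × UnitAddTorus d =>
      sliceConv (Ψ j) (FunctionSpaces.Torus.partialDeriv i (FunctionSpaces.Torus.partialDeriv i K)) q.1 q.2) μ :=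
    fun j i => (hmem (hΨm j) (hΨ3 j) (hKii i).continuous).1
  have h2c : ∀ q : ℝ × UnitAddTorus d, |(fun _ : ℝ × UnitAddTorus d => (2 : ℝ)) q| ≤ 2 := fun q => by norm_num
  -- convergence of the four summands
  have hc3a : ∀ j, Tendsto (fun n => eLpNorm (fun q : ℝ × UnitAddTorus d =>
      FunctionSpaces.Torus.laplacian (ψ q.1) q.2 * FunctionSpaces.Torus.stConv (ρ n) K (Uc j) q.1 q.2 -
        FunctionSpaces.Torus.laplacian (ψ q.1) q.2 * sliceConv (Uc j) K q.1 q.2) 3 μ) atTop (𝓝 0) := fun j =>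
    tendsto_eLpNorm_mul_sub_mul hcψL (hconv (hUm j) (hU1 j) (hU3 j) hKc)
  have hc3b : ∀ j, Tendsto (fun n => eLpNorm (fun q : ℝ × UnitAddTorus d =>
      (fun _ : ℝ × UnitAddTorus d => (2 : ℝ)) q * ∑ i, FunctionSpaces.Torus.partialDeriv i (ψ q.1) q.2 *
          FunctionSpaces.Torus.stConv (ρ n) (FunctionSpaces.Torus.partialDeriv i K) (Uc j) q.1 q.2 -
        (fun _ : ℝ × UnitAddTorus d => (2 : ℝ)) q * ∑ i, FunctionSpaces.Torus.partialDeriv i (ψ q.1) q.2 *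
          sliceConv (Uc j) (FunctionSpaces.Torus.partialDeriv i K) q.1 q.2) 3 μ) atTop (𝓝 0) := fun j =>
    tendsto_eLpNorm_mul_sub_mul h2c (tendsto_eLpNorm_finset_sum_sub Finset.univ h13
      (fun i _ => Eventually.of_forall fun n => (m3b1 n j i).sub (m3b1i j i))
      (fun i _ => tendsto_eLpNorm_mul_sub_mul (hcψi i) (hconv (hUm j) (hU1 j) (hU3 j) (hKi i).continuous)))
  have hc3c : ∀ j, Tendsto (fun n => eLpNorm (fun q : ℝ × UnitAddTorus d =>
      ψ q.1 q.2 * ∑ i, FunctionSpaces.Torus.stConv (ρ n)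
          (FunctionSpaces.Torus.partialDeriv i (FunctionSpaces.Torus.partialDeriv i K)) (Uc j) q.1 q.2 -
        ψ q.1 q.2 * ∑ i, sliceConv (Uc j) (FunctionSpaces.Torus.partialDeriv i (FunctionSpaces.Torus.partialDeriv i K)) q.1 q.2)
        3 μ) atTop (𝓝 0) := fun j =>
    tendsto_eLpNorm_mul_sub_mul hcψ (tendsto_eLpNorm_finset_sum_sub Finset.univ h13
      (fun i _ => Eventually.of_forall fun n => (m3c1 n j i).sub (m3c1i j i))
      (fun i _ => hconv (hUm j) (hU1 j) (hU3 j) (hKii i).continuous))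
  have hc3d : ∀ j, Tendsto (fun n => eLpNorm (fun q : ℝ × UnitAddTorus d =>
      ∑ i, FunctionSpaces.Torus.stConv (ρ n) (FunctionSpaces.Torus.partialDeriv i (FunctionSpaces.Torus.partialDeriv i K))
          (Ψ j) q.1 q.2 -
        ∑ i, sliceConv (Ψ j) (FunctionSpaces.Torus.partialDeriv i (FunctionSpaces.Torus.partialDeriv i K)) q.1 q.2) 3 μ)
        atTop (𝓝 0) := fun j =>
    tendsto_eLpNorm_finset_sum_sub Finset.univ h13 (fun i _ => Eventually.of_forall fun n => (m3d1 n j i).sub (m3d1i j i))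
      (fun i _ => hconv (hΨm j) (hΨ1 j) (hΨ3 j) (hKii i).continuous)
  have hg3m : ∀ n j, AEStronglyMeasurable (g3 n j) μ := fun n j =>
    (((m3a n j).add (aestronglyMeasurable_const.mul (Finset.aestronglyMeasurable_fun_sum _ fun i _ => m3b1 n j i))).add
      (hcψc.aestronglyMeasurable.mul (Finset.aestronglyMeasurable_fun_sum _ fun i _ => m3c1 n j i))).add
      (Finset.aestronglyMeasurable_fun_sum _ fun i _ => m3d1 n j i)
  have hg3im' : ∀ j, AEStronglyMeasurable (g3i j) μ := fun j =>
    (((m3ai j).add (aestronglyMeasurable_const.mul (Finset.aestronglyMeasurable_fun_sum _ fun i _ => m3b1i j i))).add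
      (hcψc.aestronglyMeasurable.mul (Finset.aestronglyMeasurable_fun_sum _ fun i _ => m3c1i j i))).add
      (Finset.aestronglyMeasurable_fun_sum _ fun i _ => m3d1i j i)
  have hg3im : ∀ j, MemLp (g3i j) 3 μ := fun j =>
    (((hmem_mul hcψLc hcψL (hmem (hUm j) (hU3 j) hKc)).add
      ((memLp_finsetSum Finset.univ fun i _ => hmem_mul (hcψic i) (hcψi i) (hmem (hUm j) (hU3 j) (hKi i).continuous)).const_mul 2)).add
      (hmem_mul hcψc hcψ (memLp_finsetSum Finset.univ fun i _ => hmem (hUm j) (hU3 j) (hKii i).continuous))).add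
      (memLp_finsetSum Finset.univ fun i _ => hmem (hΨm j) (hΨ3 j) (hKii i).continuous)
  have hg3conv : ∀ j, Tendsto (fun n => eLpNorm (fun q => g3 n j q - g3i j q) 3 μ) atTop (𝓝 0) := by
    intro j
    have hA := tendsto_eLpNorm_add_sub_add h13
      (Eventually.of_forall fun n => (m3a n j).sub (m3ai j))
      (Eventually.of_forall fun n => (aestronglyMeasurable_const.mul (Finset.aestronglyMeasurable_fun_sum _ fun i _ => m3b1 n j i)).sub
        (aestronglyMeasurable_const.mul (Finset.aestronglyMeasurable_fun_sum _ fun i _ => m3b1i j i)))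
      (hc3a j) (hc3b j)
    have hB := tendsto_eLpNorm_add_sub_add h13
      (Eventually.of_forall fun n => ((m3a n j).add (aestronglyMeasurable_const.mul
        (Finset.aestronglyMeasurable_fun_sum _ fun i _ => m3b1 n j i))).sub ((m3ai j).add (aestronglyMeasurable_const.mul
        (Finset.aestronglyMeasurable_fun_sum _ fun i _ => m3b1i j i))))
      (Eventually.of_forall fun n => (hcψc.aestronglyMeasurable.mul (Finset.aestronglyMeasurable_fun_sum _ fun i _ => m3c1 n j i)).sub
        (hcψc.aestronglyMeasurable.mul (Finset.aestronglyMeasurable_fun_sum _ fun i _ => m3c1i j i)))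
      hA (hc3c j)
    have hC := tendsto_eLpNorm_add_sub_add h13
      (Eventually.of_forall fun n => (((m3a n j).add (aestronglyMeasurable_const.mul
        (Finset.aestronglyMeasurable_fun_sum _ fun i _ => m3b1 n j i))).add (hcψc.aestronglyMeasurable.mul
        (Finset.aestronglyMeasurable_fun_sum _ fun i _ => m3c1 n j i))).sub (((m3ai j).add (aestronglyMeasurable_const.mul
        (Finset.aestronglyMeasurable_fun_sum _ fun i _ => m3b1i j i))).add (hcψc.aestronglyMeasurable.mul
        (Finset.aestronglyMeasurable_fun_sum _ fun i _ => m3c1i j i))))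
      (Eventually.of_forall fun n => (Finset.aestronglyMeasurable_fun_sum _ fun i _ => m3d1 n j i).sub
        (Finset.aestronglyMeasurable_fun_sum _ fun i _ => m3d1i j i))
      hB (hc3d j)
    exact hC
  have hT3lim : Tendsto (fun n => ∑ j, ∫ q, Uc j q * FunctionSpaces.Torus.laplacian (φc n j q.1) q.2 ∂μ) atTop
      (𝓝 (∑ j, ∫ q, Uc j q * g3i j q ∂μ)) := by
    refine tendsto_finsetSum _ fun j _ => ?_
    have e : ∀ n, (fun q => Uc j q * FunctionSpaces.Torus.laplacian (φc n j q.1) q.2) = fun q => Uc j q * g3 n j q := fun n => by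
      funext q; rw [hdL n j q.1 q.2]
    simp_rw [e]
    exact tendsto_integral_mul_of_tendsto_eLpNorm_three (hU32' j) (hg3m · j) (hg3im j) (hg3conv j)
  ---------------------------------------------------------------- Term 4 (pressure)
  have hT4lim : Tendsto (fun n => ∫ q, stBarScalar T p q * ∑ i, FunctionSpaces.Torus.partialDeriv i (φc n i q.1) q.2 ∂μ) atTop
      (𝓝 (∫ q, stBarScalar T p q * ∑ i, g2i i i q ∂μ)) := by
    have e : ∀ n, (fun q => stBarScalar T p q * ∑ i, FunctionSpaces.Torus.partialDeriv i (φc n i q.1) q.2) =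
        fun q => stBarScalar T p q * ∑ i, g2 n i i q := fun n => by
      funext q
      congr 1
      exact Finset.sum_congr rfl fun i _ => hdx n i i q.1 q.2
    simp_rw [e]
    exact tendsto_integral_mul_of_tendsto_eLpNorm_three hpbar32 (fun n => Finset.aestronglyMeasurable_fun_sum _ fun i _ => hg2m n i i)
      (memLp_finsetSum Finset.univ fun i _ => hg2im i i)
      (tendsto_eLpNorm_finset_sum_sub Finset.univ h13 (fun i _ => Eventually.of_forall fun n => (hg2m n i i).sub (hg2im i i).1)
        fun i _ => hg2conv i i)
  ---------------------------------------------------------------- the limit identity on `ℝ × T^d`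
  have hlimit : ∑ j, ∫ q, Uc j q * g1i j q ∂μ + ∑ j, ∑ i, ∫ q, Uc j q * Uc i q * g2i j i q ∂μ +
      ν * ∑ j, ∫ q, Uc j q * g3i j q ∂μ + ∫ q, stBarScalar T p q * ∑ i, g2i i i q ∂μ = 0 := by
    have h := ((hT1lim.add hT2lim).add (hT3lim.const_mul ν)).add hT4lim
    have e : (fun n => ∑ j, ∫ q, Uc j q * FunctionSpaces.Torus.timeDeriv (φc n j) q.1 q.2 ∂μ +
        ∑ j, ∑ i, ∫ q, Uc j q * Uc i q * FunctionSpaces.Torus.partialDeriv i (φc n j q.1) q.2 ∂μ +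
        ν * ∑ j, ∫ q, Uc j q * FunctionSpaces.Torus.laplacian (φc n j q.1) q.2 ∂μ +
        ∫ q, stBarScalar T p q * ∑ i, FunctionSpaces.Torus.partialDeriv i (φc n i q.1) q.2 ∂μ) = fun _ => (0 : ℝ) :=
      funext hEn
    rw [e] at h
    exact tendsto_nhds_unique h tendsto_const_nhds
  ------------------------------------------------------------------ identification of the limits
  haveI := FunctionSpaces.holderTriple_threeHalves_three
  -- from integrals over `ℝ × T^d` to iterated integrals over `(0,T)`
  have hiter : ∀ {F : ℝ × UnitAddTorus d → ℝ} (_ : Integrable F μ) {G : ℝ → UnitAddTorus d → ℝ}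
      (_ : ∀ᵐ t ∂(volume : Measure ℝ), (t ∈ Ioo 0 T → ∫ y, F (t, y) = ∫ y, G t y) ∧ (t ∉ Ioo 0 T → ∫ y, F (t, y) = 0)),
      ∫ q, F q ∂μ = ∫ t in Ioo 0 T, ∫ y, G t y := by
    intro F hF G hsl
    rw [integral_prod _ hF, ← integral_indicator measurableSet_Ioo]
    refine integral_congr_ae ?_
    filter_upwards [hsl] with t ht
    by_cases hmem : t ∈ Ioo 0 T
    · rw [indicator_of_mem hmem, ht.1 hmem]
    · rw [indicator_of_notMem hmem, ht.2 hmem]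
  -- a.e. slice data
  have hL3 : ∀ᵐ t ∂(volume.restrict (Ioo 0 T)), MemLp (u t) 3 volume := ae_memLp_three_of_lintegral hm hu3
  have hL1' : ∀ᵐ t ∂(volume : Measure ℝ), t ∈ Ioo 0 T → Integrable (u t) volume :=
    (ae_restrict_iff' measurableSet_Ioo).1 (hL3.mono fun t ht => ht.integrable (by norm_num))
  have hgoodt : ∀ᵐ t ∂(volume : Measure ℝ), (∀ j, (fun y => Uc j (t, y)) =ᵐ[volume] fun y => stBar T u (t, y) j) ∧
      (t ∈ Ioo 0 T → Integrable (u t) volume) := (ae_slice_eq_of_ae_eq_stBar hUc).and hL1'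
  -- slice-wise consequences at a good time inside `(0,T)`
  have hin : ∀ {t : ℝ} (_ : t ∈ Ioo 0 T) (_ : ∀ j, (fun y => Uc j (t, y)) =ᵐ[volume] fun y => stBar T u (t, y) j)
      (k : UnitAddTorus d → ℝ) (j : d),
      sliceConv (Uc j) k t = (fun y => u t y j) ⋆ k ∧ sliceConv (Ψ j) k t = (fun y => ψ t y * u t y j) ⋆ k ∧
        (∀ᵐ y ∂(volume : Measure (UnitAddTorus d)), Uc j (t, y) = u t y j) := by
    intro t ht hs k j
    have hslice : (fun y => Uc j (t, y)) =ᵐ[volume] fun y => u t y j := by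
      filter_upwards [hs j] with y hy
      rw [hy, stBar_apply_of_mem ht]
    have hsliceΨ : (fun y => Ψ j (t, y)) =ᵐ[volume] fun y => ψ t y * u t y j := by
      filter_upwards [hslice] with y hy
      simp only [hΨdef, hy]
    exact ⟨FunctionSpaces.Torus.convolution_congr_ae_left (ContinuousLinearMap.lsmul ℝ ℝ) hslice k,
      FunctionSpaces.Torus.convolution_congr_ae_left (ContinuousLinearMap.lsmul ℝ ℝ) hsliceΨ k, hslice⟩
  have hout : ∀ {t : ℝ} (_ : t ∉ Ioo 0 T) (_ : ∀ j, (fun y => Uc j (t, y)) =ᵐ[volume] fun y => stBar T u (t, y) j) (j : d),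
      ∀ᵐ y ∂(volume : Measure (UnitAddTorus d)), Uc j (t, y) = 0 := by
    intro t ht hs j
    filter_upwards [hs j] with y hy
    rw [hy, stBar_apply_of_not_mem ht]
    rfl
  ---------------------------------------------------------------- identification: Term 1
  have hI1 : ∑ j, ∫ q, Uc j q * g1i j q ∂μ =
      ∫ t in Ioo 0 T, ∫ x, ⟪u t x, vecConv (u t) K x⟫ * FunctionSpaces.Torus.timeDeriv ψ t x := by
    have hFj : ∀ j, Integrable (fun q => Uc j q * g1i j q) μ := fun j =>
      (hU32' j).integrable_mul (hmem_mul hcψtc hcψt (hmem (hUm j) (hU3 j) hKc))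
    rw [← integral_finsetSum _ fun j _ => hFj j]
    refine hiter (integrable_finsetSum _ fun j _ => hFj j) ?_
    filter_upwards [hgoodt] with t ht
    constructor
    · intro hmem
      refine integral_congr_ae ?_
      have hall : ∀ᵐ y ∂(volume : Measure (UnitAddTorus d)), ∀ j, Uc j (t, y) = u t y j :=
        ae_all_iff.2 fun j => (hin hmem ht.1 K j).2.2
      filter_upwards [hall] with y hy
      rw [PiLp.inner_apply, Finset.sum_mul]
      refine Finset.sum_congr rfl fun j _ => ?_
      simp only [hg1i, hy j, (hin hmem ht.1 K j).1, vecConv_apply]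
      show u t y j * (FunctionSpaces.Torus.timeDeriv ψ t y * ((fun y => u t y j) ⋆ K) y) = _
      simp only [RCLike.inner_apply, conj_trivial]
      ring
    · intro hmem
      refine integral_eq_zero_of_ae ?_
      have hall : ∀ᵐ y ∂(volume : Measure (UnitAddTorus d)), ∀ j, Uc j (t, y) = 0 := ae_all_iff.2 fun j => hout hmem ht.1 j
      filter_upwards [hall] with y hy
      rw [Pi.zero_apply]
      exact Finset.sum_eq_zero fun j _ => by rw [hy j, zero_mul]
  ---------------------------------------------------------------- identification: Term 2
  have hI2 : ∑ j, ∑ i, ∫ q, Uc j q * Uc i q * g2i j i q ∂μ =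
      ∫ t in Ioo 0 T, ∫ x, ⟪u t x, FunctionSpaces.Torus.convect (u t) (symmTestField K (ψ t) (u t)) x⟫ := by
    have hFji : ∀ j i, Integrable (fun q => Uc j q * Uc i q * g2i j i q) μ := fun j i =>
      (hU32 j i).integrable_mul (hg2im j i)
    have hsum : ∑ j, ∑ i, ∫ q, Uc j q * Uc i q * g2i j i q ∂μ = ∫ q, ∑ j, ∑ i, Uc j q * Uc i q * g2i j i q ∂μ := by
      rw [integral_finsetSum _ fun j _ => integrable_finsetSum _ fun i _ => hFji j i]
      refine Finset.sum_congr rfl fun j _ => ?_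
      rw [integral_finsetSum _ fun i _ => hFji j i]
    rw [hsum]
    refine hiter (integrable_finsetSum _ fun j _ => integrable_finsetSum _ fun i _ => hFji j i) ?_
    filter_upwards [hgoodt] with t ht
    constructor
    · intro hmem
      have hut : Integrable (u t) volume := ht.2 hmem
      have hΦ1 : FunctionSpaces.Torus.IsContDiff 1 (symmTestField K (ψ t) (u t)) :=
        (isSmooth_symmTestField hK (hψslice t) hut).isContDiff (by simp)
      refine integral_congr_ae ?_
      have hall : ∀ᵐ y ∂(volume : Measure (UnitAddTorus d)), ∀ j, Uc j (t, y) = u t y j :=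
        ae_all_iff.2 fun j => (hin hmem ht.1 K j).2.2
      filter_upwards [hall] with y hy
      rw [inner_convect_eq_sum hΦ1 (u t y) (u t) y]
      refine Finset.sum_congr rfl fun j _ => ?_
      rw [Finset.mul_sum]
      refine Finset.sum_congr rfl fun i _ => ?_
      have e1 : ∀ k, sliceConv (Uc j) k t = (fun y => u t y j) ⋆ k := fun k => (hin hmem ht.1 k j).1
      have e2 : ∀ k, sliceConv (Ψ j) k t = (fun y => ψ t y * u t y j) ⋆ k := fun k => (hin hmem ht.1 k j).2.1
      rw [partialDeriv_symmTestField_kernel hK (hψslice t) hut i j y]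
      simp only [hg2i, hy j, hy i, e1, e2]
      ring
    · intro hmem
      refine integral_eq_zero_of_ae ?_
      have hall : ∀ᵐ y ∂(volume : Measure (UnitAddTorus d)), ∀ j, Uc j (t, y) = 0 := ae_all_iff.2 fun j => hout hmem ht.1 j
      filter_upwards [hall] with y hy
      rw [Pi.zero_apply]
      exact Finset.sum_eq_zero fun j _ => Finset.sum_eq_zero fun i _ => by rw [hy j, zero_mul, zero_mul]
  ---------------------------------------------------------------- identification: Term 3
  have hI3 : ∑ j, ∫ q, Uc j q * g3i j q ∂μ =
      ∫ t in Ioo 0 T, ∫ x, ⟪u t x, FunctionSpaces.Torus.laplacian (symmTestField K (ψ t) (u t)) x⟫ := by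
    have hFj : ∀ j, Integrable (fun q => Uc j q * g3i j q) μ := fun j => (hU32' j).integrable_mul (hg3im j)
    rw [← integral_finsetSum _ fun j _ => hFj j]
    refine hiter (integrable_finsetSum _ fun j _ => hFj j) ?_
    filter_upwards [hgoodt] with t ht
    constructor
    · intro hmem
      have hut : Integrable (u t) volume := ht.2 hmem
      refine integral_congr_ae ?_
      have hall : ∀ᵐ y ∂(volume : Measure (UnitAddTorus d)), ∀ j, Uc j (t, y) = u t y j :=
        ae_all_iff.2 fun j => (hin hmem ht.1 K j).2.2
      filter_upwards [hall] with y hy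
      rw [inner_laplacian_symmTestField_eq_sum hK (hψslice t) hut (u t y) y]
      refine Finset.sum_congr rfl fun j _ => ?_
      have e1 : ∀ k, sliceConv (Uc j) k t = (fun y => u t y j) ⋆ k := fun k => (hin hmem ht.1 k j).1
      have e2 : ∀ k, sliceConv (Ψ j) k t = (fun y => ψ t y * u t y j) ⋆ k := fun k => (hin hmem ht.1 k j).2.1
      rw [laplacian_symmTestField_apply hK (hψslice t) hut j y]
      simp only [hg3i, hy j, e1, e2]
    · intro hmem
      refine integral_eq_zero_of_ae ?_
      have hall : ∀ᵐ y ∂(volume : Measure (UnitAddTorus d)), ∀ j, Uc j (t, y) = 0 := ae_all_iff.2 fun j => hout hmem ht.1 j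
      filter_upwards [hall] with y hy
      rw [Pi.zero_apply]
      exact Finset.sum_eq_zero fun j _ => by rw [hy j, zero_mul]
  ---------------------------------------------------------------- identification: Term 4
  have hI4 : ∫ q, stBarScalar T p q * ∑ i, g2i i i q ∂μ =
      ∫ t in Ioo 0 T, ∫ x, p t x * FunctionSpaces.Torus.divergence (symmTestField K (ψ t) (u t)) x := by
    have hF : Integrable (fun q => stBarScalar T p q * ∑ i, g2i i i q) μ :=
      hpbar32.integrable_mul (memLp_finsetSum Finset.univ fun i _ => hg2im i i)
    refine hiter hF ?_
    filter_upwards [hgoodt] with t ht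
    constructor
    · intro hmem
      have hut : Integrable (u t) volume := ht.2 hmem
      refine integral_congr_ae ?_
      have hall : ∀ᵐ y ∂(volume : Measure (UnitAddTorus d)), ∀ j, Uc j (t, y) = u t y j :=
        ae_all_iff.2 fun j => (hin hmem ht.1 K j).2.2
      filter_upwards [hall] with y hy
      rw [stBarScalar_apply_of_mem hmem, divergence_symmTestField_eq_sum hK (hψslice t) hut y]
      congr 1
      refine Finset.sum_congr rfl fun i _ => ?_
      have e1 : ∀ k, sliceConv (Uc i) k t = (fun y => u t y i) ⋆ k := fun k => (hin hmem ht.1 k i).1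
      have e2 : ∀ k, sliceConv (Ψ i) k t = (fun y => ψ t y * u t y i) ⋆ k := fun k => (hin hmem ht.1 k i).2.1
      simp only [hg2i, e1, e2]
    · intro hmem
      refine integral_eq_zero_of_ae (Eventually.of_forall fun y => ?_)
      show stBarScalar T p (t, y) * ∑ i, g2i i i (t, y) = 0
      rw [stBarScalar_apply_of_not_mem hmem, zero_mul]
  ---------------------------------------------------------------- conclusion
  rw [hI1, hI2, hI3, hI4] at hlimit
  exact hlimit

end Discharge

end Literature.Analysis.FluidPDE.Torus
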